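import Mathlib
import Literature.Computability.QuantumComplexity.GaussianPermanentFourthMoment
import HarnessLib

/-!
# The stochastic trace estimator with COMPLEX noise (random phase / `Z_N` / complex Gaussian):
# unbiasedness and the exact variance

Topic `Probability/Moments`.  PUBLISHED RESULTS with our formalisation (product measures over
Mathlib; every statement proved, no named fact introduced).  This is the complex companion of
`Literature/Probability/Moments/StochasticTraceEstimator.lean` (real noise, real matrices), closing
its stated "TODO(general form) (ii): the complex (`Z_N`, `U(1)`) noises of Dong–Liu and complex
Hermitian `M` are not treated", and of `Literature/Analysis/Matrix/LogDetDerivative.lean` ("NOT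
here: the complex-Gaussian Hutchinson identity `E[χ†Aχ] = tr A`").

Sources (READ on the materialised texts).
* T. Iitaka, T. Ebisuzaki, *Random phase vector for calculating the trace of a large matrix*,
  Phys. Rev. E 69 (2004) 057701 [cond-mat/0401202] — the primary followed here: eqs. (2)–(4)
  (a complex random vector `|Φ⟩ = Σ_n |n⟩ ξ_n` with i.i.d. `ξ_n`, `⟨⟨ξ_n⟩⟩ = 0`,
  `⟨⟨ξ_{n₁}ξ_{n₂}⟩⟩ = 0`, `⟨⟨ξ*_{n₁}ξ_{n₂}⟩⟩ = δ_{n₁n₂}`), eq. (13) (`⟨⟨⟨Φ|X|Φ⟩⟩⟩ = tr X` for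
  ANY matrix `X`), eq. (14) (the fluctuation `δX`), eq. (16)
  (`|δX|² = (1/K){(⟨⟨|ξ_n|⁴⟩⟩ − 1) Σ_n |X_nn|² + Σ_{n₁≠n₂} |X_{n₁n₂}|²}`), eq. (17)
  (`⟨⟨|ξ|⁴⟩⟩ ≥ ⟨⟨|ξ|²⟩⟩² = 1`, "the fluctuation becomes the smallest … if and only if `|ξ_n| = 1`"),
  eq. (18) (the random phase vector `ξ_n = e^{iθ_n}`), eq. (22)
  (`|δX|² = (1/K) Σ_{n₁≠n₂}|X_{n₁n₂}|²` for random phase vectors), eqs. (23)–(27) (REAL random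
  vectors and symmetric `X`: `|δX|² = (1/K){(⟨⟨ξ⁴⟩⟩ − 1)Σ|X_nn|² + 2Σ_{n₁≠n₂}|X_{n₁n₂}|²}`, random
  sign vectors give `(2/K)Σ_{n₁≠n₂}|X|²`, "twice of the fluctuation of random phase vectors") and
  the sentence after eq. (29) ("`⟨⟨|ξ_n|⁴⟩⟩ = 1, 2, 1` and `3`" for random phase, complex Gaussian,
  random sign and real Gaussian vectors).  Equation numbers are those of the arXiv version, counted
  in order of display.
* S.-J. Dong, K.-F. Liu, *Stochastic estimation with `Z₂` noise*, Phys. Lett. B 328 (1994) 130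
  [hep-lat/9308015], READ: eq. (1), eq. (5) and "Since `Z₂`, or `Z_N` for that matter, has no
  diagonal error, i.e. `C₂ = 0`, it produces a minimum variance".
* M. S. Albergo et al., *Flow-based sampling for fermionic lattice field theories*, Phys. Rev.
  D 104 (2021) 114507 [2106.05934], READ: App. C eq. (C1)
  (`∇ log det ℳ = Tr[ℳ⁻¹∇ℳ] = E_{χ∼e^{−χ†χ}}[(ℳ⁻¹χ)† ∇ℳ χ]`, "the noise vector `χ` is assumed to be
  drawn from the unit-variance isotropic distribution") and §IV.B.5 (Convex Potential Flows: the same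
  estimator for `∇ log det H_u(x)`, "the sample mean over noise vectors `χ` can be used to estimate this
  quantity in practice").

Lean reading.  The index set is a `Fintype` `n`; a COMPLEX UNIT NOISE law is a probability measure
`ν` on `ℂ` with `∫ z dν = 0`, `∫ |z|² dν = 1` and a finite fourth moment (`IsComplexUnitNoise ν`);
its PSEUDO-VARIANCE is `s = pvar ν = ∫ z² dν` (Iitaka–Ebisuzaki's class (3) is `s = 0`; a REAL unit
noise read in `ℂ` has `s = 1`) and its fourth moment is `m₄ = mfour ν = ∫ |z|⁴ dν`.  The noise
VECTOR has i.i.d. components, i.e. the product law `Measure.pi (fun _ : n => ν)` on `n → ℂ`.  The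
single-probe estimator of a complex square matrix `A` is `cEst A η = Σᵢ Σⱼ Aᵢⱼ η̄ᵢ ηⱼ = η† A η`
(`cEst_eq_dotProduct`).

Contents (all proved).
* `integral_cmono` & co.: the bi-degree monomial calculus `E[Π_m η_m^{a_m} η̄_m^{b_m}] = Π_m
  E[z^{a_m} z̄^{b_m}]` (independence), the vanishing of every monomial containing a LONE factor
  `η_m` or `η̄_m`, and the surviving fourth moments `E[η̄ᵢηⱼη_k η̄_l]` (`i ≠ j`, `k ≠ l`)
  `= [k = i ∧ l = j] + |s|²[k = j ∧ l = i]`.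
* **`integral_cEst`** — UNBIASEDNESS `E[η†Aη] = tr A` for EVERY complex unit noise and EVERY
  complex square `A` (Iitaka–Ebisuzaki eq. (13); the complex-Gaussian Hutchinson identity of
  Albergo et al. (C1)), with the two-matrix form **`integral_star_mulVec_dotProduct_mulVec`**
  `E[(Mχ)†(Nχ)] = tr(M†N)` as printed in (C1).
* **`variance_cEst`** — the EXACT VARIANCE for a general complex unit noise:
  `E|η†Aη − tr A|² = (m₄ − 1) Σᵢ |Aᵢᵢ|² + Σ_{i≠j} |Aᵢⱼ|² + |s|² Σ_{i≠j} Re(Aᵢⱼ Āⱼᵢ)` — the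
  common proof behind the printed complex (`s = 0`, eq. (16)) and real-symmetric (`s = 1`,
  eq. (26)) formulas, which are the corollaries **`variance_cEst_of_pvar_eq_zero`** and
  **`variance_cEst_real_symm`**.
* **`one_le_mfour`**, **`mfour_eq_one_iff`**, **`offDiag_le_variance_cEst`**,
  **`variance_cEst_of_unimodular`** — OPTIMALITY (eq. (17) and the sentence after it; Dong–Liu's
  "`Z_N` … no diagonal error"): `m₄ ≥ 1` with equality iff `|ξ| = 1` a.s.; within the class `s = 0`
  the variance is at least the noise-independent off-diagonal term `Σ_{i≠j}|Aᵢⱼ|²`, attained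
  exactly by the unimodular noises (eq. (22)).
* Instances: **`isComplexUnitNoise_stdComplexGaussian`** (`s = 0`, `m₄ = 2`, variance `‖A‖²_F` —
  `variance_cEst_gaussian`), the `Z_N` laws **`zLaw N`** (`N ≥ 2`: unit noise with `m₄ = 1`;
  `N ≥ 3`: `s = 0`, variance `Σ_{i≠j}|Aᵢⱼ|²` — `variance_cEst_zLaw`; `N = 2`: `s = 1`, the random
  SIGN vector) and the random PHASE law **`phaseLaw`** (`U(1)`: `s = 0`, `m₄ = 1`,
  `variance_cEst_phaseLaw` = eq. (22)).
* `K` independent probes divide the variance by `K` (the factor `1/K` of eq. (16)):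
  **`variance_avgCEst`**, by reading the `K` probes as one probe of `I_K ⊗ A`.
* (Appended §) the complex MATRIX-ELEMENT estimator of Dong–Liu: solving `MX = η` and averaging
  `Xᵢ η̄ⱼ` estimates `M⁻¹ᵢⱼ` — **`integral_cElemEst`** (`E[Xᵢη̄ⱼ] = Bᵢⱼ`, `B = M⁻¹`, eq. (2)) with the
  exact variance **`variance_cElemEst`** `E|Xᵢη̄ⱼ − Bᵢⱼ|² = (m₄ − 1)|Bᵢⱼ|² + Σ_{k≠j}|Bᵢₖ|²` (eq. (5) at
  `L = 1`: the pseudo-variance does NOT enter, and the first term is absent for every unimodular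
  noise — "`Z₂`, or `Z_N` for that matter, has no diagonal error").

Scope and deliberate omissions.  (i) Third moments `E[z²z̄]` are NOT assumed to vanish (they never
enter).  (ii) No `(ε, δ)` sample-size bounds.  (iii) The basis-dependence discussion and the
self-averaging estimates (eqs. (19)–(21), (28)–(30)) are not formalised.  (iv) For HERMITIAN `A`
the `s`-term reads `|s|² Σ_{i≠j}((Re Aᵢⱼ)² − (Im Aᵢⱼ)²)` (`variance_cEst_hermitian`); the source
prints only the real-symmetric case.

Context (cell pub-lqcd, HOME/R2-SCOPE.md §3 N2 / E9 "Hutchinson probes", §3 E7 training ledger):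
these are the `Z₂ ⊗ iZ₂`, `Z_N`, `U(1)` and complex-Gaussian probes actually used on Dirac
operators; `variance_cEst` is the precise form of "its variance is configuration-dependent".
-/

noncomputable section

open MeasureTheory ProbabilityTheory Complex
open scoped ComplexConjugate ENNReal NNReal

namespace Literature.Probability.Moments

/-! ## Complex unit noise laws -/

/-- A COMPLEX UNIT NOISE law: a probability measure on `ℂ` with `⟨⟨ξ⟩⟩ = 0`, `⟨⟨ξ̄ ξ⟩⟩ = 1` (stated
as `∫ |z|² = 1`) and a finite fourth moment — conditions (2) and (4) of one component; condition
(3) (`⟨⟨ξξ⟩⟩ = 0`) is NOT part of the structure but the hypothesis `pvar ν = 0` where needed.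
[cite: IitakaEbisuzaki2004, eqs. (2)–(4)]; [cite: DongLiu1994, eq. (1)] -/
structure IsComplexUnitNoise (ν : Measure ℂ) [IsProbabilityMeasure ν] : Prop where
  integrable_norm_pow_four : Integrable (fun z : ℂ => ‖z‖ ^ 4) ν
  integral_id : ∫ z, z ∂ν = 0
  integral_norm_sq : ∫ z, ‖z‖ ^ 2 ∂ν = 1

namespace ComplexNoiseTrace

variable {n : Type*} [Fintype n] [DecidableEq n]
variable {ν : Measure ℂ} [IsProbabilityMeasure ν]

/-- The PSEUDO-VARIANCE `s = ⟨⟨ξ ξ⟩⟩ = ∫ z² dν` of the noise (zero in Iitaka–Ebisuzaki's class,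
eq. (3); one for a real noise). [cite: IitakaEbisuzaki2004, eq. (3)] -/
def pvar (ν : Measure ℂ) : ℂ := ∫ z, z ^ 2 ∂ν

/-- The FOURTH MOMENT `m₄ = ⟨⟨|ξ|⁴⟩⟩ = ∫ |z|⁴ dν` of the noise. [cite: IitakaEbisuzaki2004,
eq. (16) (the factor `⟨⟨|ξ_n|⁴⟩⟩ − 1`)] -/
def mfour (ν : Measure ℂ) : ℝ := ∫ z, ‖z‖ ^ 4 ∂ν

/-- The mixed moment `⟨⟨ξ^p ξ̄^q⟩⟩ = ∫ z^p z̄^q dν`. [cite: IitakaEbisuzaki2004, eqs. (2)–(4)] -/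
def mom (ν : Measure ℂ) (p q : ℕ) : ℂ := ∫ z, z ^ p * conj z ^ q ∂ν

omit [IsProbabilityMeasure ν] in
/-- `z ↦ z^p z̄^q` is continuous, hence (ae-strongly) measurable. [folklore] -/
private theorem continuous_pow_mul_conj_pow (p q : ℕ) :
    Continuous fun z : ℂ => z ^ p * conj z ^ q :=
  (continuous_id.pow p).mul (Complex.continuous_conj.pow q)

/-- Every power `|z|^k`, `k ≤ 4`, is integrable against a complex unit noise (`|z|^k ≤ 1 + |z|⁴`).
[cite: IitakaEbisuzaki2004, eq. (16) (finiteness of the fluctuation)] -/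
theorem integrable_norm_pow (hν : IsComplexUnitNoise ν) {k : ℕ} (hk : k ≤ 4) :
    Integrable (fun z : ℂ => ‖z‖ ^ k) ν := by
  refine ((integrable_const (1 : ℝ)).add hν.integrable_norm_pow_four).mono' (by fun_prop)
    (ae_of_all _ fun z => ?_)
  simp only [Real.norm_eq_abs, abs_pow, abs_norm, Pi.add_apply]
  rcases le_or_gt ‖z‖ 1 with h | h
  · calc ‖z‖ ^ k ≤ 1 := pow_le_one₀ (norm_nonneg z) h
      _ ≤ 1 + ‖z‖ ^ 4 := le_add_of_nonneg_right (by positivity)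
  · calc ‖z‖ ^ k ≤ ‖z‖ ^ 4 := pow_le_pow_right₀ h.le hk
      _ ≤ 1 + ‖z‖ ^ 4 := le_add_of_nonneg_left zero_le_one

/-- Every mixed moment `z^p z̄^q` with `p + q ≤ 4` is integrable. [cite: IitakaEbisuzaki2004,
eq. (16) (finiteness of the fluctuation)] -/
theorem integrable_pow_mul_conj_pow (hν : IsComplexUnitNoise ν) {p q : ℕ} (hpq : p + q ≤ 4) :
    Integrable (fun z : ℂ => z ^ p * conj z ^ q) ν := by
  refine (integrable_norm_pow hν hpq).mono' (continuous_pow_mul_conj_pow p q).aestronglyMeasurable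
    (ae_of_all _ fun z => ?_)
  rw [norm_mul, norm_pow, norm_pow, Complex.norm_conj, pow_add]

/-- `⟨⟨ξ⁰ξ̄⁰⟩⟩ = 1` (normalisation). [cite: IitakaEbisuzaki2004, eqs. (2)–(4)] -/
theorem mom_zero_zero : mom ν 0 0 = 1 := by
  simp [mom]

/-- `⟨⟨ξ⟩⟩ = 0`. [cite: IitakaEbisuzaki2004, eq. (2)] -/
theorem mom_one_zero (hν : IsComplexUnitNoise ν) : mom ν 1 0 = 0 := by
  simp [mom, hν.integral_id]

/-- `⟨⟨ξ̄⟩⟩ = 0`. [cite: IitakaEbisuzaki2004, eq. (2)] -/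
theorem mom_zero_one (hν : IsComplexUnitNoise ν) : mom ν 0 1 = 0 := by
  simp only [mom, pow_zero, pow_one, one_mul]
  rw [integral_conj, hν.integral_id, map_zero]

/-- `⟨⟨ξ ξ̄⟩⟩ = ⟨⟨|ξ|²⟩⟩ = 1`. [cite: IitakaEbisuzaki2004, eq. (4)] -/
theorem mom_one_one (hν : IsComplexUnitNoise ν) : mom ν 1 1 = 1 := by
  simp only [mom, pow_one]
  have e : ∀ z : ℂ, z * conj z = ((‖z‖ ^ 2 : ℝ) : ℂ) := fun z => by
    rw [Complex.mul_conj, Complex.normSq_eq_norm_sq]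
  simp_rw [e, integral_complex_ofReal, hν.integral_norm_sq, Complex.ofReal_one]

omit [IsProbabilityMeasure ν] in
/-- `⟨⟨ξ²⟩⟩ = s`. [cite: IitakaEbisuzaki2004, eq. (3)] -/
theorem mom_two_zero : mom ν 2 0 = pvar ν := by
  simp [mom, pvar]

omit [IsProbabilityMeasure ν] in
/-- `⟨⟨ξ̄²⟩⟩ = s̄`. [cite: IitakaEbisuzaki2004, eq. (3)] -/
theorem mom_zero_two : mom ν 0 2 = conj (pvar ν) := by
  simp only [mom, pvar, pow_zero, one_mul, ← map_pow]
  exact integral_conj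

omit [IsProbabilityMeasure ν] in
/-- `⟨⟨ξ²ξ̄²⟩⟩ = ⟨⟨|ξ|⁴⟩⟩ = m₄`. [cite: IitakaEbisuzaki2004, eq. (16)] -/
theorem mom_two_two : mom ν 2 2 = (mfour ν : ℂ) := by
  simp only [mom, mfour]
  have e : ∀ z : ℂ, z ^ 2 * conj z ^ 2 = ((‖z‖ ^ 4 : ℝ) : ℂ) := fun z => by
    rw [← mul_pow, Complex.mul_conj, Complex.normSq_eq_norm_sq]
    push_cast
    ring
  simp_rw [e, integral_complex_ofReal]

/-- **Every complex unit noise has fourth moment at least one**: `⟨⟨|ξ|⁴⟩⟩ ≥ ⟨⟨|ξ|²⟩⟩² = 1`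
(`0 ≤ ∫ (|z|² − 1)² = m₄ − 1`). [cite: IitakaEbisuzaki2004, eq. (17)] -/
theorem one_le_mfour (hν : IsComplexUnitNoise ν) : 1 ≤ mfour ν := by
  have h0 : 0 ≤ ∫ z, (‖z‖ ^ 2 - 1) ^ 2 ∂ν := integral_nonneg fun z => by positivity
  have hexp : ∫ z, (‖z‖ ^ 2 - 1) ^ 2 ∂ν = mfour ν - 1 := by
    have h4 : Integrable (fun z : ℂ => ‖z‖ ^ 4) ν := hν.integrable_norm_pow_four
    have h2 : Integrable (fun z : ℂ => 2 * ‖z‖ ^ 2) ν :=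
      (integrable_norm_pow hν (show 2 ≤ 4 by norm_num)).const_mul 2
    have h42 : Integrable (fun z : ℂ => ‖z‖ ^ 4 - 2 * ‖z‖ ^ 2) ν := h4.sub h2
    have e : (fun z : ℂ => (‖z‖ ^ 2 - 1) ^ 2) = fun z => ‖z‖ ^ 4 - 2 * ‖z‖ ^ 2 + 1 := by
      ext z; ring
    rw [e, integral_add h42 (integrable_const _), integral_sub h4 h2, integral_const_mul,
      hν.integral_norm_sq, mfour]
    simp only [integral_const, probReal_univ, smul_eq_mul, mul_one]
    ring
  linarith

/-- The "diagonal error" vanishes exactly for UNIMODULAR noise: `m₄ = 1 ↔ |ξ| = 1` a.s. ("the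
fluctuation becomes the smallest … if and only if `|ξ_n| = 1` for each `n` and for each sample").
[cite: IitakaEbisuzaki2004, sentence after eq. (17)] -/
theorem mfour_eq_one_iff (hν : IsComplexUnitNoise ν) :
    mfour ν = 1 ↔ ∀ᵐ z ∂ν, ‖z‖ = 1 := by
  have h4 : Integrable (fun z : ℂ => ‖z‖ ^ 4) ν := hν.integrable_norm_pow_four
  have h2 : Integrable (fun z : ℂ => 2 * ‖z‖ ^ 2) ν :=
    (integrable_norm_pow hν (show 2 ≤ 4 by norm_num)).const_mul 2
  have h42 : Integrable (fun z : ℂ => ‖z‖ ^ 4 - 2 * ‖z‖ ^ 2) ν := h4.sub h2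
  have e : (fun z : ℂ => (‖z‖ ^ 2 - 1) ^ 2) = fun z => ‖z‖ ^ 4 - 2 * ‖z‖ ^ 2 + 1 := by
    ext z; ring
  have hint : Integrable (fun z : ℂ => (‖z‖ ^ 2 - 1) ^ 2) ν := by
    rw [e]; exact h42.add (integrable_const _)
  have hexp : ∫ z, (‖z‖ ^ 2 - 1) ^ 2 ∂ν = mfour ν - 1 := by
    rw [e, integral_add h42 (integrable_const _), integral_sub h4 h2, integral_const_mul,
      hν.integral_norm_sq, mfour]
    simp only [integral_const, probReal_univ, smul_eq_mul, mul_one]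
    ring
  have key : mfour ν = 1 ↔ ∫ z, (‖z‖ ^ 2 - 1) ^ 2 ∂ν = 0 := by
    rw [hexp]; constructor <;> intro h <;> linarith
  rw [key, integral_eq_zero_iff_of_nonneg (fun z => by simp only [Pi.zero_apply]; positivity) hint]
  have hpt : ∀ z : ℂ, ((‖z‖ ^ 2 - 1) ^ 2 = 0) ↔ ‖z‖ = 1 := by
    intro z
    rw [sq_eq_zero_iff, sub_eq_zero, pow_eq_one_iff_of_nonneg (norm_nonneg z) two_ne_zero]
  constructor
  · intro h
    filter_upwards [h] with z hz
    exact (hpt z).mp hz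
  · intro h
    filter_upwards [h] with z hz
    exact (hpt z).mpr hz

/-! ## Bi-degree monomials in the noise components and their expectations -/

/-- The exponent pattern "coordinate `i` once": `ind i m = [m = i]`.
[cite: IitakaEbisuzaki2004, eq. (15) (bookkeeping of which `ξ`'s appear)] -/
def ind (i : n) : n → ℕ := fun m => if m = i then 1 else 0

omit [Fintype n] in
/-- Unfolding `ind`. [cite: IitakaEbisuzaki2004, eq. (15)] -/
@[simp] theorem ind_apply (i m : n) : ind i m = if m = i then 1 else 0 := rfl

/-- The monomial `Π_m η_m^{a_m} η̄_m^{b_m}` in the noise components and their conjugates.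
[cite: IitakaEbisuzaki2004, eq. (15) (the products `ξ*_{n₁}ξ_{n₂}ξ_{n₃}ξ*_{n₄}`)] -/
def cmono (a b : n → ℕ) (η : n → ℂ) : ℂ := ∏ m, (η m ^ a m * conj (η m) ^ b m)

omit [DecidableEq n] in
/-- Monomials multiply by adding exponents. [cite: IitakaEbisuzaki2004, eq. (15)] -/
theorem cmono_add (a b a' b' : n → ℕ) (η : n → ℂ) :
    cmono (a + a') (b + b') η = cmono a b η * cmono a' b' η := by
  unfold cmono
  rw [← Finset.prod_mul_distrib]
  exact Finset.prod_congr rfl fun m _ => by simp only [Pi.add_apply, pow_add]; ring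

/-- The monomial `(ind a, ind b)` is `η_a η̄_b`. [cite: IitakaEbisuzaki2004, eq. (15)] -/
theorem cmono_single (a b : n) (η : n → ℂ) : cmono (ind a) (ind b) η = η a * conj (η b) := by
  have h1 : ∀ m, η m ^ ind a m = if m = a then η m else 1 := fun m => by
    unfold ind; split_ifs <;> simp
  have h2 : ∀ m, conj (η m) ^ ind b m = if m = b then conj (η m) else 1 := fun m => by
    unfold ind; split_ifs <;> simp
  unfold cmono
  rw [Finset.prod_mul_distrib, Finset.prod_congr rfl fun m _ => h1 m,
    Finset.prod_congr rfl fun m _ => h2 m, Finset.prod_ite_eq', Finset.prod_ite_eq']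
  simp

omit [DecidableEq n] [IsProbabilityMeasure ν] in
/-- **Fubini for monomials**: `E[Π_m η_m^{a_m} η̄_m^{b_m}] = Π_m ⟨⟨ξ^{a_m} ξ̄^{b_m}⟩⟩` (independence
of the components). [cite: IitakaEbisuzaki2004, eq. (16) ("carefully evaluating
`⟨⟨ξ*ξξξ*⟩⟩` by using (2)–(4)")] -/
theorem integral_cmono [SigmaFinite ν] (a b : n → ℕ) :
    ∫ η, cmono a b η ∂(Measure.pi fun _ : n => ν) = ∏ m, mom ν (a m) (b m) := by
  unfold cmono mom
  exact integral_fintype_prod_eq_prod (𝕜 := ℂ) (fun m (z : ℂ) => z ^ a m * conj z ^ b m)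

omit [DecidableEq n] in
/-- Monomials of total degree `≤ 4` in each variable are integrable.
[cite: IitakaEbisuzaki2004, eq. (16) (finiteness)] -/
theorem integrable_cmono (hν : IsComplexUnitNoise ν) {a b : n → ℕ} (h : ∀ m, a m + b m ≤ 4) :
    Integrable (cmono a b) (Measure.pi fun _ : n => ν) := by
  unfold cmono
  exact Integrable.fintype_prod (f := fun m (z : ℂ) => z ^ a m * conj z ^ b m)
    (fun m => integrable_pow_mul_conj_pow hν (h m))

omit [DecidableEq n] in
/-- A monomial in which some component appears as a LONE factor `η_m` or `η̄_m` has mean zero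
(`⟨⟨ξ⟩⟩ = ⟨⟨ξ̄⟩⟩ = 0`, independence). [cite: IitakaEbisuzaki2004, eq. (2)] -/
theorem integral_cmono_eq_zero (hν : IsComplexUnitNoise ν) {a b : n → ℕ}
    (h : ∃ m, (a m = 1 ∧ b m = 0) ∨ (a m = 0 ∧ b m = 1)) :
    ∫ η, cmono a b η ∂(Measure.pi fun _ : n => ν) = 0 := by
  rw [integral_cmono]
  obtain ⟨m, hm⟩ := h
  refine Finset.prod_eq_zero (Finset.mem_univ m) ?_
  rcases hm with ⟨h1, h0⟩ | ⟨h0, h1⟩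
  · rw [h1, h0]; exact mom_one_zero hν
  · rw [h0, h1]; exact mom_zero_one hν

omit [DecidableEq n] in
/-- A monomial all of whose bi-exponents are `(0,0)` or `(1,1)` has mean one (`⟨⟨|ξ|²⟩⟩ = 1`,
independence). [cite: IitakaEbisuzaki2004, eq. (4)] -/
theorem integral_cmono_eq_one (hν : IsComplexUnitNoise ν) {a b : n → ℕ}
    (h : ∀ m, (a m = 0 ∧ b m = 0) ∨ (a m = 1 ∧ b m = 1)) :
    ∫ η, cmono a b η ∂(Measure.pi fun _ : n => ν) = 1 := by
  rw [integral_cmono]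
  refine Finset.prod_eq_one fun m _ => ?_
  rcases h m with ⟨h0, h0'⟩ | ⟨h1, h1'⟩
  · rw [h0, h0']; exact mom_zero_zero
  · rw [h1, h1']; exact mom_one_one hν

/-! ## Mixed moments of the noise vector -/

section Moments

variable (hν : IsComplexUnitNoise ν)
include hν

/-- **White noise**: `⟨⟨η̄ᵢ ηⱼ⟩⟩ = δᵢⱼ`. [cite: IitakaEbisuzaki2004, eq. (4)];
[cite: DongLiu1994, eq. (1)] -/
theorem integral_conj_mul (i j : n) :
    ∫ η, conj (η i) * η j ∂(Measure.pi fun _ : n => ν) = if i = j then 1 else 0 := by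
  have e : (fun η : n → ℂ => conj (η i) * η j) = cmono (ind j) (ind i) := by
    ext η; rw [cmono_single, mul_comm]
  rw [e]
  split_ifs with h
  · subst h
    exact integral_cmono_eq_one hν fun m => by by_cases hm : m = i <;> simp [hm]
  · exact integral_cmono_eq_zero hν ⟨i, Or.inr (by simp [h])⟩

/-- `η̄ᵢ ηⱼ` is integrable. [cite: IitakaEbisuzaki2004, eq. (4)] -/
theorem integrable_conj_mul (i j : n) :
    Integrable (fun η : n → ℂ => conj (η i) * η j) (Measure.pi fun _ : n => ν) := by
  have e : (fun η : n → ℂ => conj (η i) * η j) = cmono (ind j) (ind i) := by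
    ext η; rw [cmono_single, mul_comm]
  rw [e]
  exact integrable_cmono hν fun m => by
    simp only [ind_apply]; split_ifs <;> omega

omit hν in
/-- The four-factor products as monomials. [cite: IitakaEbisuzaki2004, eq. (15)] -/
private theorem four_eq_cmono (i j k l : n) :
    (fun η : n → ℂ => conj (η i) * η j * (η k * conj (η l))) =
      cmono (ind j + ind k) (ind i + ind l) := by
  ext η; rw [cmono_add, cmono_single, cmono_single]; ring

/-- **Fourth mixed moment with two off-diagonal pairs**: for `i ≠ j` and `k ≠ l`,
`⟨⟨η̄ᵢ ηⱼ · η_k η̄_l⟩⟩ = [k = i ∧ l = j] + |s|² [k = j ∧ l = i]` (all other index patterns contain a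
lone component; the second pattern pairs `η̄ᵢ²` with `ηⱼ²` and is absent when `s = 0`).
[cite: IitakaEbisuzaki2004, eqs. (15)–(16)] -/
theorem integral_off_off {i j k l : n} (hij : i ≠ j) (hkl : k ≠ l) :
    ∫ η, conj (η i) * η j * (η k * conj (η l)) ∂(Measure.pi fun _ : n => ν) =
      (if k = i ∧ l = j then 1 else 0) +
        (if k = j ∧ l = i then pvar ν * conj (pvar ν) else 0) := by
  rw [four_eq_cmono]
  by_cases h1 : k = i ∧ l = j
  · have h2 : ¬(k = j ∧ l = i) := fun h => hij (h1.1.symm.trans h.1)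
    rw [if_pos h1, if_neg h2, add_zero]
    obtain ⟨rfl, rfl⟩ := h1
    exact integral_cmono_eq_one hν fun m => by
      by_cases hmk : m = k <;> by_cases hml : m = l <;> simp_all
  · by_cases h2 : k = j ∧ l = i
    · rw [if_neg h1, if_pos h2, zero_add]
      obtain ⟨rfl, rfl⟩ := h2
      rw [integral_cmono, Finset.prod_eq_mul k l hkl]
      · have ek : (ind k + ind k) k = 2 := by simp
        have ek' : (ind l + ind l) k = 0 := by simp [hkl]
        have el : (ind k + ind k) l = 0 := by simp [Ne.symm hkl]
        have el' : (ind l + ind l) l = 2 := by simp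
        rw [ek, ek', el, el', mom_two_zero, mom_zero_two]
      · intro m _ hm
        have h0 : (ind k + ind k) m = 0 := by simp [hm.1]
        have h0' : (ind l + ind l) m = 0 := by simp [hm.2]
        rw [h0, h0']
        exact mom_zero_zero
      · intro h; exact absurd (Finset.mem_univ k) h
      · intro h; exact absurd (Finset.mem_univ l) h
    · rw [if_neg h1, if_neg h2, add_zero]
      apply integral_cmono_eq_zero hν
      by_cases hki : k = i
      · have hlj : l ≠ j := fun h => h1 ⟨hki, h⟩
        have hlk : l ≠ k := fun h => hkl h.symm
        have hli : l ≠ i := fun h => hlk (h.trans hki.symm)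
        exact ⟨l, Or.inr (by simp [hlj, hlk, hli])⟩
      · by_cases hkj : k = j
        · have hli : l ≠ i := fun h => h2 ⟨hkj, h⟩
          have hlk : l ≠ k := fun h => hkl h.symm
          have hlj : l ≠ j := fun h => hlk (h.trans hkj.symm)
          exact ⟨l, Or.inr (by simp [hlj, hlk, hli])⟩
        · exact ⟨k, Or.inl (by simp [hki, hkj, hkl])⟩

/-- `η̄ᵢ ηⱼ η_k η̄_l` is integrable. [cite: IitakaEbisuzaki2004, eq. (16) (finiteness)] -/
theorem integrable_off_off (i j k l : n) :
    Integrable (fun η : n → ℂ => conj (η i) * η j * (η k * conj (η l)))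
      (Measure.pi fun _ : n => ν) := by
  rw [four_eq_cmono]
  exact integrable_cmono hν fun m => by
    simp only [Pi.add_apply, ind_apply]; split_ifs <;> omega

omit hν in
/-- The diagonal-times-pair product as monomials. [cite: IitakaEbisuzaki2004, eq. (15)] -/
private theorem diag_off_eq_cmono (i k l : n) :
    (fun η : n → ℂ => (conj (η i) * η i - 1) * (η k * conj (η l))) =
      fun η => cmono (ind i + ind k) (ind i + ind l) η - cmono (ind k) (ind l) η := by
  ext η; rw [cmono_add, cmono_single, cmono_single]; ring

/-- `⟨⟨(η̄ᵢηᵢ − 1) η_k η̄_l⟩⟩ = 0` for `k ≠ l` (the diagonal and off-diagonal parts of the estimator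
are uncorrelated). [cite: IitakaEbisuzaki2004, eq. (16) (no cross term)];
[cite: DongLiu1994, eq. (5)] -/
theorem integral_diag_off (i : n) {k l : n} (hkl : k ≠ l) :
    ∫ η, (conj (η i) * η i - 1) * (η k * conj (η l)) ∂(Measure.pi fun _ : n => ν) = 0 := by
  have hA : ∫ η, cmono (ind i + ind k) (ind i + ind l) η ∂(Measure.pi fun _ : n => ν) = 0 := by
    apply integral_cmono_eq_zero hν
    by_cases hki : k = i
    · have hlk : l ≠ k := fun h => hkl h.symm
      have hli : l ≠ i := fun h => hlk (h.trans hki.symm)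
      exact ⟨l, Or.inr (by simp [hlk, hli])⟩
    · exact ⟨k, Or.inl (by simp [hki, hkl])⟩
  have hB : ∫ η, cmono (ind k) (ind l) η ∂(Measure.pi fun _ : n => ν) = 0 :=
    integral_cmono_eq_zero hν ⟨k, Or.inl (by simp [hkl])⟩
  have hiA : Integrable (cmono (ind i + ind k) (ind i + ind l)) (Measure.pi fun _ : n => ν) :=
    integrable_cmono hν fun m => by
      simp only [Pi.add_apply, ind_apply]; split_ifs <;> omega
  have hiB : Integrable (cmono (ind k) (ind l)) (Measure.pi fun _ : n => ν) :=
    integrable_cmono hν fun m => by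
      simp only [ind_apply]; split_ifs <;> omega
  rw [diag_off_eq_cmono, integral_sub hiA hiB, hA, hB, sub_zero]

/-- `(η̄ᵢηᵢ − 1) η_k η̄_l` is integrable. [cite: IitakaEbisuzaki2004, eq. (16) (finiteness)] -/
theorem integrable_diag_off (i k l : n) :
    Integrable (fun η : n → ℂ => (conj (η i) * η i - 1) * (η k * conj (η l)))
      (Measure.pi fun _ : n => ν) := by
  rw [diag_off_eq_cmono]
  refine Integrable.sub ?_ ?_
  · exact integrable_cmono hν fun m => by
      simp only [Pi.add_apply, ind_apply]; split_ifs <;> omega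
  · exact integrable_cmono hν fun m => by
      simp only [ind_apply]; split_ifs <;> omega

omit hν in
/-- The pair-times-diagonal product as monomials. [cite: IitakaEbisuzaki2004, eq. (15)] -/
private theorem off_diag_eq_cmono (i j k : n) :
    (fun η : n → ℂ => conj (η i) * η j * (η k * conj (η k) - 1)) =
      fun η => cmono (ind j + ind k) (ind i + ind k) η - cmono (ind j) (ind i) η := by
  ext η; rw [cmono_add, cmono_single, cmono_single]; ring

/-- `⟨⟨η̄ᵢ ηⱼ (η_k η̄_k − 1)⟩⟩ = 0` for `i ≠ j` (the mirror cross term).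
[cite: IitakaEbisuzaki2004, eq. (16) (no cross term)] -/
theorem integral_off_diag {i j : n} (hij : i ≠ j) (k : n) :
    ∫ η, conj (η i) * η j * (η k * conj (η k) - 1) ∂(Measure.pi fun _ : n => ν) = 0 := by
  have hA : ∫ η, cmono (ind j + ind k) (ind i + ind k) η ∂(Measure.pi fun _ : n => ν) = 0 := by
    apply integral_cmono_eq_zero hν
    by_cases hki : k = i
    · have hjk : j ≠ k := fun h => hij (hki.symm.trans h.symm)
      exact ⟨j, Or.inl (by simp [hjk, Ne.symm hij])⟩
    · exact ⟨i, Or.inr (by simp [hij, Ne.symm hki])⟩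
  have hB : ∫ η, cmono (ind j) (ind i) η ∂(Measure.pi fun _ : n => ν) = 0 :=
    integral_cmono_eq_zero hν ⟨i, Or.inr (by simp [hij])⟩
  have hiA : Integrable (cmono (ind j + ind k) (ind i + ind k)) (Measure.pi fun _ : n => ν) :=
    integrable_cmono hν fun m => by
      simp only [Pi.add_apply, ind_apply]; split_ifs <;> omega
  have hiB : Integrable (cmono (ind j) (ind i)) (Measure.pi fun _ : n => ν) :=
    integrable_cmono hν fun m => by
      simp only [ind_apply]; split_ifs <;> omega
  rw [off_diag_eq_cmono, integral_sub hiA hiB, hA, hB, sub_zero]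

/-- `η̄ᵢ ηⱼ (η_k η̄_k − 1)` is integrable. [cite: IitakaEbisuzaki2004, eq. (16) (finiteness)] -/
theorem integrable_off_diag (i j k : n) :
    Integrable (fun η : n → ℂ => conj (η i) * η j * (η k * conj (η k) - 1))
      (Measure.pi fun _ : n => ν) := by
  rw [off_diag_eq_cmono]
  refine Integrable.sub ?_ ?_
  · exact integrable_cmono hν fun m => by
      simp only [Pi.add_apply, ind_apply]; split_ifs <;> omega
  · exact integrable_cmono hν fun m => by
      simp only [ind_apply]; split_ifs <;> omega

omit hν in
/-- The diagonal-times-diagonal product as monomials. [cite: IitakaEbisuzaki2004, eq. (15)] -/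
private theorem diag_diag_eq_cmono (i k : n) :
    (fun η : n → ℂ => (conj (η i) * η i - 1) * (η k * conj (η k) - 1)) =
      fun η => cmono (ind i + ind k) (ind i + ind k) η - cmono (ind i) (ind i) η
        - cmono (ind k) (ind k) η + 1 := by
  ext η; rw [cmono_add, cmono_single, cmono_single]; ring

/-- **The diagonal block**: `⟨⟨(η̄ᵢηᵢ − 1)(η_k η̄_k − 1)⟩⟩ = δᵢₖ (m₄ − 1)` — the "diagonal error"
`⟨⟨|ξ|⁴⟩⟩ − 1` of the noise. [cite: IitakaEbisuzaki2004, eq. (16) (first term)];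
[cite: DongLiu1994, eq. (5) (`C₂²` term)] -/
theorem integral_diag_diag (i k : n) :
    ∫ η, (conj (η i) * η i - 1) * (η k * conj (η k) - 1) ∂(Measure.pi fun _ : n => ν) =
      if i = k then ((mfour ν : ℂ) - 1) else 0 := by
  have hiA : Integrable (cmono (ind i + ind k) (ind i + ind k)) (Measure.pi fun _ : n => ν) :=
    integrable_cmono hν fun m => by
      simp only [Pi.add_apply, ind_apply]; split_ifs <;> omega
  have hiB : Integrable (cmono (ind i) (ind i)) (Measure.pi fun _ : n => ν) :=
    integrable_cmono hν fun m => by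
      simp only [ind_apply]; split_ifs <;> omega
  have hiC : Integrable (cmono (ind k) (ind k)) (Measure.pi fun _ : n => ν) :=
    integrable_cmono hν fun m => by
      simp only [ind_apply]; split_ifs <;> omega
  have hiAB : Integrable (fun η => cmono (ind i + ind k) (ind i + ind k) η - cmono (ind i) (ind i) η)
      (Measure.pi fun _ : n => ν) := hiA.sub hiB
  have hiABC : Integrable (fun η => cmono (ind i + ind k) (ind i + ind k) η
      - cmono (ind i) (ind i) η - cmono (ind k) (ind k) η) (Measure.pi fun _ : n => ν) :=
    hiAB.sub hiC
  have hB : ∫ η, cmono (ind i) (ind i) η ∂(Measure.pi fun _ : n => ν) = 1 :=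
    integral_cmono_eq_one hν fun m => by by_cases hm : m = i <;> simp [hm]
  have hC : ∫ η, cmono (ind k) (ind k) η ∂(Measure.pi fun _ : n => ν) = 1 :=
    integral_cmono_eq_one hν fun m => by by_cases hm : m = k <;> simp [hm]
  rw [diag_diag_eq_cmono, integral_add hiABC (integrable_const _), integral_sub hiAB hiC,
    integral_sub hiA hiB, hB, hC]
  simp only [integral_const, probReal_univ, one_smul]
  split_ifs with hik
  · subst hik
    rw [integral_cmono, Finset.prod_eq_single i]
    · have h2 : (ind i + ind i) i = 2 := by simp
      rw [h2, mom_two_two]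
      ring
    · intro m _ hm
      have h0 : (ind i + ind i) m = 0 := by simp [hm]
      rw [h0]
      exact mom_zero_zero
    · intro h; exact absurd (Finset.mem_univ i) h
  · have hA : ∫ η, cmono (ind i + ind k) (ind i + ind k) η ∂(Measure.pi fun _ : n => ν) = 1 :=
      integral_cmono_eq_one hν fun m => by
        by_cases hmi : m = i <;> by_cases hmk : m = k <;> simp_all
    rw [hA]
    ring

/-- `(η̄ᵢηᵢ − 1)(η_k η̄_k − 1)` is integrable. [cite: IitakaEbisuzaki2004, eq. (16)] -/
theorem integrable_diag_diag (i k : n) :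
    Integrable (fun η : n → ℂ => (conj (η i) * η i - 1) * (η k * conj (η k) - 1))
      (Measure.pi fun _ : n => ν) := by
  rw [diag_diag_eq_cmono]
  refine ((Integrable.sub (Integrable.sub ?_ ?_) ?_).add (integrable_const _))
  · exact integrable_cmono hν fun m => by
      simp only [Pi.add_apply, ind_apply]; split_ifs <;> omega
  · exact integrable_cmono hν fun m => by
      simp only [ind_apply]; split_ifs <;> omega
  · exact integrable_cmono hν fun m => by
      simp only [ind_apply]; split_ifs <;> omega

end Moments

/-! ## Finite-sum plumbing -/

variable {P : Measure (n → ℂ)}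

omit [DecidableEq n] in
/-- Integral of a double finite sum of integrable functions. [cite: IitakaEbisuzaki2004,
eq. (13) (linearity of `⟨⟨·⟩⟩`)] -/
theorem integral_sum₂ {f : n → n → (n → ℂ) → ℂ} (hf : ∀ i j, Integrable (f i j) P) :
    ∫ η, ∑ i, ∑ j, f i j η ∂P = ∑ i, ∑ j, ∫ η, f i j η ∂P := by
  rw [integral_finsetSum _ fun i _ => integrable_finsetSum _ fun j _ => hf i j]
  exact Finset.sum_congr rfl fun i _ => integral_finsetSum _ fun j _ => hf i j

omit [DecidableEq n] in
/-- Integral of a triple finite sum of integrable functions. [cite: IitakaEbisuzaki2004,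
eq. (16) (linearity of `⟨⟨·⟩⟩`)] -/
theorem integral_sum₃ {f : n → n → n → (n → ℂ) → ℂ} (hf : ∀ i j k, Integrable (f i j k) P) :
    ∫ η, ∑ i, ∑ j, ∑ k, f i j k η ∂P = ∑ i, ∑ j, ∑ k, ∫ η, f i j k η ∂P := by
  rw [integral_finsetSum _ fun i _ =>
    integrable_finsetSum _ fun j _ => integrable_finsetSum _ fun k _ => hf i j k]
  exact Finset.sum_congr rfl fun i _ => integral_sum₂ (hf i)

omit [DecidableEq n] in
/-- Integral of a quadruple finite sum of integrable functions. [cite: IitakaEbisuzaki2004,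
eq. (16) (linearity of `⟨⟨·⟩⟩`)] -/
theorem integral_sum₄ {f : n → n → n → n → (n → ℂ) → ℂ}
    (hf : ∀ i j k l, Integrable (f i j k l) P) :
    ∫ η, ∑ i, ∑ j, ∑ k, ∑ l, f i j k l η ∂P = ∑ i, ∑ j, ∑ k, ∑ l, ∫ η, f i j k l η ∂P := by
  rw [integral_finsetSum _ fun i _ => integrable_finsetSum _ fun j _ =>
    integrable_finsetSum _ fun k _ => integrable_finsetSum _ fun l _ => hf i j k l]
  exact Finset.sum_congr rfl fun i _ => integral_sum₃ (hf i)

omit [DecidableEq n] in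
/-- `Σ_k Σ_l [k = i ∧ l = j] f k l = f i j`. [cite: IitakaEbisuzaki2004, eq. (16) (collecting
the surviving index patterns)] -/
theorem sum_sum_ite_and [DecidableEq n] (f : n → n → ℂ) (i j : n) :
    ∑ k, ∑ l, (if k = i ∧ l = j then f k l else 0) = f i j := by
  rw [Finset.sum_eq_single i, Finset.sum_eq_single j]
  · simp
  · intro l _ hl; simp [hl]
  · simp
  · intro k _ hk; simp [hk]
  · simp

/-! ## The complex trace estimator -/

/-- The single-probe STOCHASTIC TRACE ESTIMATOR `η† A η = Σᵢ Σⱼ Aᵢⱼ η̄ᵢ ηⱼ` of a complex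
square matrix (`⟨Φ|X|Φ⟩`). [cite: IitakaEbisuzaki2004, eq. (13)];
[cite: AlbergoEtAl2021Fermions, App. C eq. (C1)] -/
def cEst (A : Matrix n n ℂ) (η : n → ℂ) : ℂ := ∑ i, ∑ j, A i j * (conj (η i) * η j)

omit [DecidableEq n] in
/-- `cEst A η` is the sesquilinear form `η† A η = star η ⬝ᵥ (A *ᵥ η)`.
[cite: IitakaEbisuzaki2004, eq. (13)] -/
theorem cEst_eq_dotProduct (A : Matrix n n ℂ) (η : n → ℂ) :
    cEst A η = dotProduct (star η) (A.mulVec η) := by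
  unfold cEst dotProduct Matrix.mulVec dotProduct
  refine Finset.sum_congr rfl fun i _ => ?_
  rw [Pi.star_apply, Complex.star_def, Finset.mul_sum]
  exact Finset.sum_congr rfl fun j _ => by ring

/-- The off-diagonal part of a matrix (diagonal zeroed). [cite: IitakaEbisuzaki2004, eq. (16)
(the term `Σ_{n₁≠n₂}|X_{n₁n₂}|²`)] -/
def coffd (A : Matrix n n ℂ) (i j : n) : ℂ := if i = j then 0 else A i j

omit [Fintype n] in
/-- The off-diagonal part has zero diagonal. [cite: IitakaEbisuzaki2004, eq. (16)] -/
@[simp] theorem coffd_self (A : Matrix n n ℂ) (i : n) : coffd A i i = 0 := by simp [coffd]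

omit [Fintype n] in
/-- Off the diagonal the off-diagonal part agrees with `A`. [cite: IitakaEbisuzaki2004,
eq. (16)] -/
theorem coffd_of_ne (A : Matrix n n ℂ) {i j : n} (h : i ≠ j) : coffd A i j = A i j := by
  simp [coffd, h]

/-- Decomposition of the fluctuation `δX = η†Aη − tr A` into the DIAGONAL part
`Σᵢ Aᵢᵢ(η̄ᵢηᵢ − 1)` and the OFF-DIAGONAL part `Σ_{i≠j} Aᵢⱼ η̄ᵢ ηⱼ`.
[cite: IitakaEbisuzaki2004, eq. (14) (`δX = Σ (ξ*_{n₁}ξ_{n₂} − δ_{n₁n₂}) X_{n₁n₂}`)] -/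
theorem cEst_sub_trace (A : Matrix n n ℂ) (η : n → ℂ) :
    cEst A η - A.trace =
      ∑ i, A i i * (conj (η i) * η i - 1) + ∑ i, ∑ j, coffd A i j * (conj (η i) * η j) := by
  have hsplit : ∀ i, ∑ j, A i j * (conj (η i) * η j) =
      A i i * (conj (η i) * η i) + ∑ j, coffd A i j * (conj (η i) * η j) := by
    intro i
    have hp : ∀ j, A i j * (conj (η i) * η j) =
        (if i = j then A i j * (conj (η i) * η j) else 0) + coffd A i j * (conj (η i) * η j) := by
      intro j; unfold coffd; split_ifs <;> simp
    rw [Finset.sum_congr rfl fun j _ => hp j, Finset.sum_add_distrib, Finset.sum_ite_eq]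
    simp
  unfold cEst
  rw [Finset.sum_congr rfl fun i _ => hsplit i, Finset.sum_add_distrib, Matrix.trace]
  simp only [Matrix.diag_apply]
  have : ∑ i, A i i * (conj (η i) * η i) - ∑ i, A i i = ∑ i, A i i * (conj (η i) * η i - 1) := by
    rw [← Finset.sum_sub_distrib]
    exact Finset.sum_congr rfl fun i _ => by ring
  linear_combination this

/-- The pseudo-variance coefficient `Σᵢⱼ (offd A)ᵢⱼ conj((offd A)ⱼᵢ)` is REAL (it is its own
conjugate after swapping the summation indices). [cite: IitakaEbisuzaki2004, sentence after
eq. (14) ("`δX` becomes real number by adding the expression … with the subscripts exchanged")] -/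
theorem conj_sum_coffd_mul_conj (A : Matrix n n ℂ) :
    conj (∑ i, ∑ j, coffd A i j * conj (coffd A j i)) =
      ∑ i, ∑ j, coffd A i j * conj (coffd A j i) := by
  rw [map_sum]
  simp_rw [map_sum, map_mul, Complex.conj_conj]
  rw [Finset.sum_comm]
  exact Finset.sum_congr rfl fun i _ => Finset.sum_congr rfl fun j _ => by ring


section CEst

variable (hν : IsComplexUnitNoise ν)
include hν

/-- **UNBIASEDNESS of the complex stochastic trace estimator**: `E[η† A η] = tr A` for i.i.d.
components of ANY complex unit noise and EVERY complex square matrix `A` (Hermitian or not; the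
pseudo-variance plays no role). [cite: IitakaEbisuzaki2004, eq. (13)
(`⟨⟨⟨Φ|X|Φ⟩⟩⟩ = Σ_n X_nn + Σ ⟨⟨ξ*ξ − δ⟩⟩X = tr X`)]; [cite: AlbergoEtAl2021Fermions, App. C
eq. (C1) (last equality)]; [cite: DongLiu1994, eq. (2)] -/
theorem integral_cEst (A : Matrix n n ℂ) :
    ∫ η, cEst A η ∂(Measure.pi fun _ : n => ν) = A.trace := by
  unfold cEst
  rw [integral_sum₂ fun i j => (integrable_conj_mul hν i j).const_mul (A i j)]
  simp_rw [integral_const_mul, integral_conj_mul hν, mul_ite, mul_one, mul_zero,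
    Finset.sum_ite_eq, Finset.mem_univ, if_true, Matrix.trace, Matrix.diag_apply]

omit [DecidableEq n] in
/-- **The two-matrix form printed in the R2 primary**: `E[(Mχ)† (Nχ)] = tr(M† N)` — with
`M = ℳ⁻¹` Hermitian and `N = ∇ℳ` this is `∇ log det ℳ = Tr[ℳ⁻¹∇ℳ] = E_χ[(ℳ⁻¹χ)†∇ℳ χ]`.
[cite: AlbergoEtAl2021Fermions, App. C eq. (C1) and §IV.B.5 (the `∇ log det H_u` display)] -/
theorem integral_star_mulVec_dotProduct_mulVec [DecidableEq n] (M N : Matrix n n ℂ) :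
    ∫ χ, dotProduct (star (M.mulVec χ)) (N.mulVec χ) ∂(Measure.pi fun _ : n => ν) =
      (M.conjTranspose * N).trace := by
  have e : ∀ χ : n → ℂ, dotProduct (star (M.mulVec χ)) (N.mulVec χ) =
      cEst (M.conjTranspose * N) χ := by
    intro χ
    rw [cEst_eq_dotProduct, Matrix.star_mulVec, ← Matrix.dotProduct_mulVec, Matrix.mulVec_mulVec]
  simp_rw [e]
  exact integral_cEst hν _

/-- **EXACT VARIANCE of the complex stochastic trace estimator for a general complex unit noise**
with pseudo-variance `s = ∫ z²` and fourth moment `m₄ = ∫ |z|⁴`, complex form: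
`E[(η†Aη − tr A)(η†Aη − tr A)^*] = (m₄ − 1) Σᵢ |Aᵢᵢ|² + Σ_{i≠j} |Aᵢⱼ|² + |s|² Σ_{i≠j} Aᵢⱼ Āⱼᵢ`
— a DIAGONAL term proportional to the "diagonal error" `⟨⟨|ξ|⁴⟩⟩ − 1`, a noise-independent
OFF-DIAGONAL term, and a PSEUDO-VARIANCE term absent in the class `⟨⟨ξξ⟩⟩ = 0`.
[cite: IitakaEbisuzaki2004, eqs. (15)–(16) and (26) (the two printed instances `s = 0`, `s = 1`)];
[cite: DongLiu1994, eq. (5)] -/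
theorem integral_err_mul_conj_err (A : Matrix n n ℂ) :
    ∫ η, (cEst A η - A.trace) * conj (cEst A η - A.trace) ∂(Measure.pi fun _ : n => ν) =
      ((mfour ν : ℂ) - 1) * ∑ i, A i i * conj (A i i) +
        ∑ i, ∑ j, coffd A i j * conj (coffd A i j) +
        pvar ν * conj (pvar ν) * ∑ i, ∑ j, coffd A i j * conj (coffd A j i) := by
  -- pointwise expansion `(D + R)(D̄ + R̄) = ΣΣ d d̄' + ΣΣΣ d r̄ + ΣΣΣ r d̄ + ΣΣΣΣ r r̄'`
  have hconjD : ∀ η : n → ℂ, conj (∑ k, A k k * (conj (η k) * η k - 1)) =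
      ∑ k, conj (A k k) * (η k * conj (η k) - 1) := by
    intro η
    rw [map_sum]
    exact Finset.sum_congr rfl fun k _ => by
      simp only [map_mul, map_sub, map_one, Complex.conj_conj]
  have hconjR : ∀ η : n → ℂ, conj (∑ k, ∑ l, coffd A k l * (conj (η k) * η l)) =
      ∑ k, ∑ l, conj (coffd A k l) * (η k * conj (η l)) := by
    intro η
    rw [map_sum]
    refine Finset.sum_congr rfl fun k _ => ?_
    rw [map_sum]
    exact Finset.sum_congr rfl fun l _ => by
      simp only [map_mul, Complex.conj_conj]
  have hexp : ∀ η : n → ℂ, (cEst A η - A.trace) * conj (cEst A η - A.trace) =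
      ∑ i, ∑ k, A i i * conj (A k k) * ((conj (η i) * η i - 1) * (η k * conj (η k) - 1)) +
      ∑ i, ∑ k, ∑ l, A i i * conj (coffd A k l) * ((conj (η i) * η i - 1) * (η k * conj (η l))) +
      ∑ i, ∑ j, ∑ k, coffd A i j * conj (A k k) * (conj (η i) * η j * (η k * conj (η k) - 1)) +
      ∑ i, ∑ j, ∑ k, ∑ l, coffd A i j * conj (coffd A k l) *
        (conj (η i) * η j * (η k * conj (η l))) := by
    intro η
    rw [cEst_sub_trace, map_add, hconjD, hconjR, add_mul, mul_add, mul_add]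
    have t1 : (∑ i, A i i * (conj (η i) * η i - 1)) * (∑ k, conj (A k k) * (η k * conj (η k) - 1)) =
        ∑ i, ∑ k, A i i * conj (A k k) * ((conj (η i) * η i - 1) * (η k * conj (η k) - 1)) := by
      rw [Finset.sum_mul_sum]
      exact Finset.sum_congr rfl fun i _ => Finset.sum_congr rfl fun k _ => by ring
    have t2 : (∑ i, A i i * (conj (η i) * η i - 1)) *
        (∑ k, ∑ l, conj (coffd A k l) * (η k * conj (η l))) =
        ∑ i, ∑ k, ∑ l, A i i * conj (coffd A k l) *
          ((conj (η i) * η i - 1) * (η k * conj (η l))) := by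
      rw [Finset.sum_mul_sum]
      exact Finset.sum_congr rfl fun i _ => Finset.sum_congr rfl fun k _ => by
        rw [Finset.mul_sum]
        exact Finset.sum_congr rfl fun l _ => by ring
    have t3 : (∑ i, ∑ j, coffd A i j * (conj (η i) * η j)) *
        (∑ k, conj (A k k) * (η k * conj (η k) - 1)) =
        ∑ i, ∑ j, ∑ k, coffd A i j * conj (A k k) *
          (conj (η i) * η j * (η k * conj (η k) - 1)) := by
      rw [Finset.sum_mul]
      refine Finset.sum_congr rfl fun i _ => ?_
      rw [Finset.sum_mul_sum]
      exact Finset.sum_congr rfl fun j _ => Finset.sum_congr rfl fun k _ => by ring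
    have t4 : (∑ i, ∑ j, coffd A i j * (conj (η i) * η j)) *
        (∑ k, ∑ l, conj (coffd A k l) * (η k * conj (η l))) =
        ∑ i, ∑ j, ∑ k, ∑ l, coffd A i j * conj (coffd A k l) *
          (conj (η i) * η j * (η k * conj (η l))) := by
      rw [Finset.sum_mul]
      refine Finset.sum_congr rfl fun i _ => ?_
      rw [Finset.sum_mul]
      refine Finset.sum_congr rfl fun j _ => ?_
      rw [Finset.mul_sum]
      refine Finset.sum_congr rfl fun k _ => ?_
      rw [Finset.mul_sum]
      exact Finset.sum_congr rfl fun l _ => by ring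
    rw [t1, t2, t3, t4]
    ring
  simp_rw [hexp]
  -- integrability of every block
  have hI1 : ∀ i k, Integrable (fun η : n → ℂ =>
      A i i * conj (A k k) * ((conj (η i) * η i - 1) * (η k * conj (η k) - 1)))
      (Measure.pi fun _ : n => ν) :=
    fun i k => (integrable_diag_diag hν i k).const_mul _
  have hI2 : ∀ i k l, Integrable (fun η : n → ℂ =>
      A i i * conj (coffd A k l) * ((conj (η i) * η i - 1) * (η k * conj (η l))))
      (Measure.pi fun _ : n => ν) :=
    fun i k l => (integrable_diag_off hν i k l).const_mul _
  have hI3 : ∀ i j k, Integrable (fun η : n → ℂ =>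
      coffd A i j * conj (A k k) * (conj (η i) * η j * (η k * conj (η k) - 1)))
      (Measure.pi fun _ : n => ν) :=
    fun i j k => (integrable_off_diag hν i j k).const_mul _
  have hI4 : ∀ i j k l, Integrable (fun η : n → ℂ =>
      coffd A i j * conj (coffd A k l) * (conj (η i) * η j * (η k * conj (η l))))
      (Measure.pi fun _ : n => ν) :=
    fun i j k l => (integrable_off_off hν i j k l).const_mul _
  have hS1 : Integrable (fun η : n → ℂ =>
      ∑ i, ∑ k, A i i * conj (A k k) * ((conj (η i) * η i - 1) * (η k * conj (η k) - 1)))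
      (Measure.pi fun _ : n => ν) :=
    integrable_finsetSum _ fun i _ => integrable_finsetSum _ fun k _ => hI1 i k
  have hS2 : Integrable (fun η : n → ℂ =>
      ∑ i, ∑ k, ∑ l, A i i * conj (coffd A k l) * ((conj (η i) * η i - 1) * (η k * conj (η l))))
      (Measure.pi fun _ : n => ν) :=
    integrable_finsetSum _ fun i _ => integrable_finsetSum _ fun k _ =>
      integrable_finsetSum _ fun l _ => hI2 i k l
  have hS3 : Integrable (fun η : n → ℂ =>
      ∑ i, ∑ j, ∑ k, coffd A i j * conj (A k k) * (conj (η i) * η j * (η k * conj (η k) - 1)))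
      (Measure.pi fun _ : n => ν) :=
    integrable_finsetSum _ fun i _ => integrable_finsetSum _ fun j _ =>
      integrable_finsetSum _ fun k _ => hI3 i j k
  have hS4 : Integrable (fun η : n → ℂ =>
      ∑ i, ∑ j, ∑ k, ∑ l, coffd A i j * conj (coffd A k l) *
        (conj (η i) * η j * (η k * conj (η l)))) (Measure.pi fun _ : n => ν) :=
    integrable_finsetSum _ fun i _ => integrable_finsetSum _ fun j _ =>
      integrable_finsetSum _ fun k _ => integrable_finsetSum _ fun l _ => hI4 i j k l
  have hS12 : Integrable (fun η : n → ℂ =>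
      ∑ i, ∑ k, A i i * conj (A k k) * ((conj (η i) * η i - 1) * (η k * conj (η k) - 1)) +
      ∑ i, ∑ k, ∑ l, A i i * conj (coffd A k l) * ((conj (η i) * η i - 1) * (η k * conj (η l))))
      (Measure.pi fun _ : n => ν) := hS1.add hS2
  have hS123 : Integrable (fun η : n → ℂ =>
      ∑ i, ∑ k, A i i * conj (A k k) * ((conj (η i) * η i - 1) * (η k * conj (η k) - 1)) +
      ∑ i, ∑ k, ∑ l, A i i * conj (coffd A k l) * ((conj (η i) * η i - 1) * (η k * conj (η l))) +
      ∑ i, ∑ j, ∑ k, coffd A i j * conj (A k k) * (conj (η i) * η j * (η k * conj (η k) - 1)))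
      (Measure.pi fun _ : n => ν) := hS12.add hS3
  rw [integral_add hS123 hS4, integral_add hS12 hS3,
    integral_add hS1 hS2, integral_sum₂ hI1, integral_sum₃ hI2, integral_sum₃ hI3,
    integral_sum₄ hI4]
  -- the diagonal block
  have hD : ∑ i, ∑ k, ∫ η, A i i * conj (A k k) * ((conj (η i) * η i - 1) * (η k * conj (η k) - 1))
      ∂(Measure.pi fun _ : n => ν) = ((mfour ν : ℂ) - 1) * ∑ i, A i i * conj (A i i) := by
    simp_rw [integral_const_mul, integral_diag_diag hν, mul_ite, mul_zero,
      Finset.sum_ite_eq, Finset.mem_univ, if_true]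
    rw [Finset.mul_sum]
    exact Finset.sum_congr rfl fun i _ => by ring
  -- both cross blocks vanish
  have hX : ∑ i, ∑ k, ∑ l, ∫ η, A i i * conj (coffd A k l) *
      ((conj (η i) * η i - 1) * (η k * conj (η l))) ∂(Measure.pi fun _ : n => ν) = 0 := by
    refine Finset.sum_eq_zero fun i _ => Finset.sum_eq_zero fun k _ =>
      Finset.sum_eq_zero fun l _ => ?_
    rw [integral_const_mul]
    by_cases hkl : k = l
    · simp [coffd, hkl]
    · rw [integral_diag_off hν i hkl, mul_zero]
  have hX' : ∑ i, ∑ j, ∑ k, ∫ η, coffd A i j * conj (A k k) *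
      (conj (η i) * η j * (η k * conj (η k) - 1)) ∂(Measure.pi fun _ : n => ν) = 0 := by
    refine Finset.sum_eq_zero fun i _ => Finset.sum_eq_zero fun j _ =>
      Finset.sum_eq_zero fun k _ => ?_
    rw [integral_const_mul]
    by_cases hij : i = j
    · simp [coffd, hij]
    · rw [integral_off_diag hν hij k, mul_zero]
  -- the off-diagonal block
  have hterm : ∀ i j k l, ∫ η, coffd A i j * conj (coffd A k l) *
      (conj (η i) * η j * (η k * conj (η l))) ∂(Measure.pi fun _ : n => ν) =
      (if k = i ∧ l = j then coffd A i j * conj (coffd A k l) else 0) +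
      (if k = j ∧ l = i then pvar ν * conj (pvar ν) * (coffd A i j * conj (coffd A k l))
        else 0) := by
    intro i j k l
    rw [integral_const_mul]
    by_cases hij : i = j
    · simp [coffd, hij]
    · by_cases hkl : k = l
      · subst hkl
        have h1 : ¬(k = i ∧ k = j) := fun h => hij (h.1.symm.trans h.2)
        have h2 : ¬(k = j ∧ k = i) := fun h => hij (h.2.symm.trans h.1)
        simp [h1, h2]
      · rw [integral_off_off hν hij hkl]
        split_ifs <;> ring
  have hR : ∑ i, ∑ j, ∑ k, ∑ l, ∫ η, coffd A i j * conj (coffd A k l) *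
      (conj (η i) * η j * (η k * conj (η l))) ∂(Measure.pi fun _ : n => ν) =
      ∑ i, ∑ j, coffd A i j * conj (coffd A i j) +
        pvar ν * conj (pvar ν) * ∑ i, ∑ j, coffd A i j * conj (coffd A j i) := by
    rw [Finset.mul_sum, ← Finset.sum_add_distrib]
    refine Finset.sum_congr rfl fun i _ => ?_
    rw [Finset.mul_sum, ← Finset.sum_add_distrib]
    refine Finset.sum_congr rfl fun j _ => ?_
    rw [Finset.sum_congr rfl fun k _ => Finset.sum_congr rfl fun l _ => hterm i j k l]
    simp_rw [Finset.sum_add_distrib]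
    rw [sum_sum_ite_and (fun k l => coffd A i j * conj (coffd A k l)) i j,
      sum_sum_ite_and (fun k l => pvar ν * conj (pvar ν) * (coffd A i j * conj (coffd A k l))) j i]
  rw [hD, hX, hX', hR]
  ring

/-- **EXACT VARIANCE of the complex stochastic trace estimator for a general complex unit noise**
(real form): with `s = ∫ z²` and `m₄ = ∫ |z|⁴`,
`E|η†Aη − tr A|² = (m₄ − 1) Σᵢ |Aᵢᵢ|² + Σ_{i≠j} |Aᵢⱼ|² + |s|² Σ_{i≠j} Re(Aᵢⱼ Āⱼᵢ)`.
Both printed fluctuation formulas — eq. (16) for the complex class `s = 0` and eq. (26) for real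
noise (`s = 1`) with symmetric `X` — are the instances below.
[cite: IitakaEbisuzaki2004, eqs. (16), (26)]; [cite: DongLiu1994, eq. (5) ("the first part is
proportional to the square of the diagonal error `C₂` only")] -/
theorem variance_cEst (A : Matrix n n ℂ) :
    ∫ η, ‖cEst A η - A.trace‖ ^ 2 ∂(Measure.pi fun _ : n => ν) =
      (mfour ν - 1) * ∑ i, ‖A i i‖ ^ 2 + ∑ i, ∑ j, ‖coffd A i j‖ ^ 2 +
        ‖pvar ν‖ ^ 2 * ∑ i, ∑ j, (coffd A i j * conj (A j i)).re := by
  have hC := integral_err_mul_conj_err hν A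
  have e : ∀ η : n → ℂ, (cEst A η - A.trace) * conj (cEst A η - A.trace) =
      ((‖cEst A η - A.trace‖ ^ 2 : ℝ) : ℂ) := fun η => by
    rw [Complex.mul_conj, Complex.normSq_eq_norm_sq]
  simp_rw [e, integral_complex_ofReal] at hC
  have hreal : (∑ i, ∑ j, coffd A i j * conj (coffd A j i)) =
      ((∑ i, ∑ j, (coffd A i j * conj (A j i)).re : ℝ) : ℂ) := by
    have hS : (∑ i, ∑ j, coffd A i j * conj (coffd A j i)) =
        (((∑ i, ∑ j, coffd A i j * conj (coffd A j i)).re : ℝ) : ℂ) :=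
      (Complex.conj_eq_iff_re.mp (conj_sum_coffd_mul_conj A)).symm
    rw [hS]
    congr 1
    rw [Complex.re_sum]
    refine Finset.sum_congr rfl fun i _ => ?_
    rw [Complex.re_sum]
    refine Finset.sum_congr rfl fun j _ => ?_
    by_cases hij : i = j
    · simp [coffd, hij]
    · rw [coffd_of_ne A (Ne.symm hij)]
  rw [hreal] at hC
  have e1 : ∀ w : ℂ, w * conj w = ((‖w‖ ^ 2 : ℝ) : ℂ) := fun w => by
    rw [Complex.mul_conj, Complex.normSq_eq_norm_sq]
  simp_rw [e1] at hC
  apply Complex.ofReal_injective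
  rw [hC]
  push_cast
  ring

/-- **Iitaka–Ebisuzaki's fluctuation formula, eq. (16)**: in the class `⟨⟨ξξ⟩⟩ = 0` (zero
pseudo-variance — random phase, `Z_N` with `N ≥ 3`, complex Gaussian),
`E|η†Aη − tr A|² = (⟨⟨|ξ|⁴⟩⟩ − 1) Σ_n |A_nn|² + Σ_{n₁≠n₂} |A_{n₁n₂}|²` for EVERY complex `A`.
[cite: IitakaEbisuzaki2004, eq. (16)] -/
theorem variance_cEst_of_pvar_eq_zero (hs : pvar ν = 0) (A : Matrix n n ℂ) :
    ∫ η, ‖cEst A η - A.trace‖ ^ 2 ∂(Measure.pi fun _ : n => ν) =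
      (mfour ν - 1) * ∑ i, ‖A i i‖ ^ 2 + ∑ i, ∑ j, ‖coffd A i j‖ ^ 2 := by
  rw [variance_cEst hν, hs]
  simp

/-- **OPTIMALITY within the class `⟨⟨ξξ⟩⟩ = 0`** ("the fluctuation becomes the smallest for a given
basis set if and only if `|ξ_n| = 1`"; Dong–Liu: "`Z_N` … no diagonal error … minimum variance"):
the variance exceeds the noise-independent off-diagonal term `Σ_{i≠j}|Aᵢⱼ|²` by
`(m₄ − 1)Σᵢ|Aᵢᵢ|² ≥ 0`. [cite: IitakaEbisuzaki2004, eq. (17) and the sentence after it];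
[cite: DongLiu1994, sentence after eq. (5)] -/
theorem offDiag_le_variance_cEst (hs : pvar ν = 0) (A : Matrix n n ℂ) :
    ∑ i, ∑ j, ‖coffd A i j‖ ^ 2 ≤
      ∫ η, ‖cEst A η - A.trace‖ ^ 2 ∂(Measure.pi fun _ : n => ν) := by
  rw [variance_cEst_of_pvar_eq_zero hν hs]
  have h1 := one_le_mfour hν
  have h2 : 0 ≤ ∑ i, ‖A i i‖ ^ 2 := Finset.sum_nonneg fun i _ => sq_nonneg _
  nlinarith

/-- **The minimum is attained by every UNIMODULAR noise of the class** (`m₄ = 1`, i.e. `|ξ| = 1`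
a.s. by `mfour_eq_one_iff`, and `s = 0`: random phase vectors, `Z_N` for `N ≥ 3`): `E|η†Aη − tr A|² = Σ_{n₁≠n₂}|A_{n₁n₂}|²`, "which becomes
zero for diagonal matrices". [cite: IitakaEbisuzaki2004, eq. (22)];
[cite: DongLiu1994, "`Z_N` … has no diagonal error, i.e. `C₂ = 0`"] -/
theorem variance_cEst_of_unimodular (hs : pvar ν = 0) (h1 : mfour ν = 1)
    (A : Matrix n n ℂ) :
    ∫ η, ‖cEst A η - A.trace‖ ^ 2 ∂(Measure.pi fun _ : n => ν) =
      ∑ i, ∑ j, ‖coffd A i j‖ ^ 2 := by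
  rw [variance_cEst_of_pvar_eq_zero hν hs, h1]
  simp

/-- **Hermitian matrices**: for `A = A†` the pseudo-variance coefficient is
`Σ_{i≠j} Re(Aᵢⱼ Āⱼᵢ) = Σ_{i≠j} Re(Aᵢⱼ²) = Σ_{i≠j} ((Re Aᵢⱼ)² − (Im Aᵢⱼ)²)`, so
`E|η†Aη − tr A|² = (m₄ − 1)Σᵢ|Aᵢᵢ|² + Σ_{i≠j}|Aᵢⱼ|² + |s|²Σ_{i≠j}((Re Aᵢⱼ)² − (Im Aᵢⱼ)²)`
(for real symmetric `A` the last two terms merge into `(1 + |s|²)Σ_{i≠j}Aᵢⱼ²`).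
[cite: IitakaEbisuzaki2004, sentence after eq. (14) (Hermitian `X`) and eqs. (23)–(26)] -/
theorem variance_cEst_hermitian {A : Matrix n n ℂ} (hA : A.IsHermitian) :
    ∫ η, ‖cEst A η - A.trace‖ ^ 2 ∂(Measure.pi fun _ : n => ν) =
      (mfour ν - 1) * ∑ i, ‖A i i‖ ^ 2 + ∑ i, ∑ j, ‖coffd A i j‖ ^ 2 +
        ‖pvar ν‖ ^ 2 * ∑ i, ∑ j, ((coffd A i j).re ^ 2 - (coffd A i j).im ^ 2) := by
  rw [variance_cEst hν]
  congr 1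
  congr 1
  refine Finset.sum_congr rfl fun i _ => Finset.sum_congr rfl fun j _ => ?_
  by_cases hij : i = j
  · simp [coffd, hij]
  · have hji : A j i = conj (A i j) := by
      have := congrFun (congrFun hA j) i
      simpa [Matrix.conjTranspose_apply] using this.symm
    rw [coffd_of_ne A hij, hji, Complex.conj_conj, Complex.mul_re]
    ring

/-- **REAL noise read in `ℂ`, SYMMETRIC real matrix — Iitaka–Ebisuzaki eq. (26)**: if the noise is
supported on `ℝ` (so `s = ⟨⟨ξ²⟩⟩ = ⟨⟨|ξ|²⟩⟩ = 1`) and `X` is real symmetric, then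
`E|η†Xη − tr X|² = (⟨⟨ξ⁴⟩⟩ − 1)Σ_n X_nn² + 2 Σ_{n₁≠n₂} X_{n₁n₂}²` — "twice" the off-diagonal
term of the random phase vector. [cite: IitakaEbisuzaki2004, eqs. (26)–(27) ("which is twice of
the fluctuation of random phase vectors")] -/
theorem variance_cEst_real_symm (hs : pvar ν = 1) {X : Matrix n n ℝ} (hX : X.IsSymm) :
    ∫ η, ‖cEst (X.map ((↑) : ℝ → ℂ)) η - (X.map ((↑) : ℝ → ℂ)).trace‖ ^ 2
        ∂(Measure.pi fun _ : n => ν) =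
      (mfour ν - 1) * ∑ i, X i i ^ 2 +
        2 * ∑ i, ∑ j, (if i = j then 0 else X i j ^ 2) := by
  rw [variance_cEst hν, hs]
  have hsym : ∀ i j, X j i = X i j := fun i j => by
    simpa using congrFun (congrFun hX i) j
  have h1 : ∑ i, ‖(X.map ((↑) : ℝ → ℂ)) i i‖ ^ 2 = ∑ i, X i i ^ 2 :=
    Finset.sum_congr rfl fun i _ => by simp [Matrix.map_apply]
  have h2 : ∑ i, ∑ j, ‖coffd (X.map ((↑) : ℝ → ℂ)) i j‖ ^ 2 =
      ∑ i, ∑ j, (if i = j then 0 else X i j ^ 2) :=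
    Finset.sum_congr rfl fun i _ => Finset.sum_congr rfl fun j _ => by
      unfold coffd; split_ifs <;> simp [Matrix.map_apply]
  have h3 : ∑ i, ∑ j, (coffd (X.map ((↑) : ℝ → ℂ)) i j * conj ((X.map ((↑) : ℝ → ℂ)) j i)).re =
      ∑ i, ∑ j, (if i = j then 0 else X i j ^ 2) :=
    Finset.sum_congr rfl fun i _ => Finset.sum_congr rfl fun j _ => by
      unfold coffd
      split_ifs
      · simp
      · simp only [Matrix.map_apply, Complex.conj_ofReal, ← Complex.ofReal_mul,
          Complex.ofReal_re, hsym i j]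
        ring
  rw [h1, h2, h3]
  simp only [norm_one, one_pow, one_mul]
  ring

end CEst

/-! ## Complex Gaussian noise `χ ∼ e^{−χ†χ}` -/

section Gaussian

open Literature.Computability.QuantumComplexity

/-- The standard complex Gaussian `𝒩(0,1)_ℂ` (density `π⁻¹e^{−|z|²}`, `E|z|² = 1` — the
"`χ ∼ e^{−χ†χ}`" of the R2 primary) is a complex unit noise. [cite: AlbergoEtAl2021Fermions,
App. C eq. (C1) ("unit-variance isotropic distribution")]; [cite: IitakaEbisuzaki2004, sentence
after eq. (29) ("complex random Gaussian vector")] -/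
theorem isComplexUnitNoise_stdComplexGaussian : IsComplexUnitNoise stdComplexGaussian where
  integrable_norm_pow_four := by
    simpa using (memLp_id_stdComplexGaussian 4 (by simp)).integrable_norm_pow (by norm_num)
  integral_id := integral_id_stdComplexGaussian
  integral_norm_sq := integral_norm_sq_stdComplexGaussian

/-- The complex Gaussian has ZERO pseudo-variance (`E z² = 0`, rotation invariance).
[cite: IitakaEbisuzaki2004, eq. (3)] -/
theorem pvar_stdComplexGaussian : pvar stdComplexGaussian = 0 :=
  integral_sq_stdComplexGaussian.1

/-- The complex Gaussian has fourth moment `⟨⟨|ξ|⁴⟩⟩ = 2`. [cite: IitakaEbisuzaki2004, sentence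
after eq. (29) ("`⟨⟨|ξ_n|⁴⟩⟩ = 1, 2, 1` and `3` respectively")] -/
theorem mfour_stdComplexGaussian : mfour stdComplexGaussian = 2 :=
  integral_norm_pow_four_stdComplexGaussian

/-- **Complex-Gaussian Hutchinson**: `E_{χ∼e^{−χ†χ}}[χ† A χ] = tr A` for every complex square `A`.
[cite: AlbergoEtAl2021Fermions, App. C eq. (C1) (last equality) and §IV.B.5] -/
theorem integral_cEst_gaussian (A : Matrix n n ℂ) :
    ∫ χ, cEst A χ ∂(Measure.pi fun _ : n => stdComplexGaussian) = A.trace :=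
  integral_cEst isComplexUnitNoise_stdComplexGaussian A

/-- **Variance with complex Gaussian noise**: `E|χ†Aχ − tr A|² = Σᵢ|Aᵢᵢ|² + Σ_{i≠j}|Aᵢⱼ|²`
`= Σᵢⱼ |Aᵢⱼ|² = ‖A‖²_F` (diagonal error `⟨⟨|ξ|⁴⟩⟩ − 1 = 1`). [cite: IitakaEbisuzaki2004,
eq. (16) with "`⟨⟨|ξ_n|⁴⟩⟩ = 2`" (sentence after eq. (29))] -/
theorem variance_cEst_gaussian (A : Matrix n n ℂ) :
    ∫ χ, ‖cEst A χ - A.trace‖ ^ 2 ∂(Measure.pi fun _ : n => stdComplexGaussian) =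
      ∑ i, ∑ j, ‖A i j‖ ^ 2 := by
  rw [variance_cEst_of_pvar_eq_zero isComplexUnitNoise_stdComplexGaussian pvar_stdComplexGaussian,
    mfour_stdComplexGaussian]
  have hsplit : ∀ i, ∑ j, ‖A i j‖ ^ 2 = ‖A i i‖ ^ 2 + ∑ j, ‖coffd A i j‖ ^ 2 := by
    intro i
    have hp : ∀ j, ‖A i j‖ ^ 2 = (if i = j then ‖A i j‖ ^ 2 else 0) + ‖coffd A i j‖ ^ 2 := by
      intro j; unfold coffd; split_ifs <;> simp
    rw [Finset.sum_congr rfl fun j _ => hp j, Finset.sum_add_distrib, Finset.sum_ite_eq]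
    simp
  rw [Finset.sum_congr rfl fun i _ => hsplit i, Finset.sum_add_distrib]
  ring

end Gaussian

/-! ## `Z_N` noise (uniform on the `N`-th roots of unity; `N = 2` is the random SIGN vector) -/

section ZN

/-- The primitive `N`-th root of unity `ζ_N = e^{2πi/N}`. [cite: DongLiu1994, "`Z₂`, or `Z_N` for
that matter"] -/
def zeta (N : ℕ) : ℂ := Complex.exp (2 * Real.pi * Complex.I / N)

/-- The `Z_N` NOISE law: uniform on `{ζ_N^k : k < N}`. [cite: DongLiu1994, "`Z₂`, or `Z_N` for that
matter, has no diagonal error"]; [cite: IitakaEbisuzaki2004, eq. (27) (random sign vector,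
`N = 2`)] -/
def zLaw (N : ℕ) : Measure ℂ :=
  ((N : ℝ≥0∞)⁻¹) • ∑ k ∈ Finset.range N, Measure.dirac (zeta N ^ k)

/-- Integration against `zLaw N` is the average over the `N` roots of unity.
[cite: DongLiu1994, eq. (1) (the stochastic average)] -/
theorem integral_zLaw (N : ℕ) (f : ℂ → ℂ) :
    ∫ z, f z ∂zLaw N = (N : ℂ)⁻¹ * ∑ k ∈ Finset.range N, f (zeta N ^ k) := by
  unfold zLaw
  rw [integral_smul_measure, integral_finsetSum_measure fun k _ => integrable_dirac enorm_lt_top]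
  simp_rw [integral_dirac]
  rw [ENNReal.toReal_inv, ENNReal.toReal_natCast, Complex.real_smul, Complex.ofReal_inv,
    Complex.ofReal_natCast]

/-- Integration of a real function against `zLaw N`. [cite: DongLiu1994, eq. (1)] -/
theorem integral_zLaw_real (N : ℕ) (f : ℂ → ℝ) :
    ∫ z, f z ∂zLaw N = (N : ℝ)⁻¹ * ∑ k ∈ Finset.range N, f (zeta N ^ k) := by
  unfold zLaw
  rw [integral_smul_measure, integral_finsetSum_measure fun k _ => integrable_dirac enorm_lt_top]
  simp_rw [integral_dirac]
  rw [ENNReal.toReal_inv, ENNReal.toReal_natCast, smul_eq_mul]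

/-- `zLaw N` is a probability measure for `N ≥ 1`. [cite: DongLiu1994, eq. (1)] -/
instance isProbabilityMeasure_zLaw (N : ℕ) [NeZero N] : IsProbabilityMeasure (zLaw N) := by
  constructor
  unfold zLaw
  simp only [Measure.smul_apply, Measure.coe_finsetSum, Finset.sum_apply,
    Measure.dirac_apply_of_mem (Set.mem_univ _), Finset.sum_const, Finset.card_range,
    smul_eq_mul, nsmul_eq_mul, mul_one]
  exact ENNReal.inv_mul_cancel (by simp [NeZero.ne N]) (by simp)

/-- `ζ_N` is a primitive `N`-th root of unity. [folklore] -/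
private theorem isPrimitiveRoot_zeta {N : ℕ} (hN : N ≠ 0) : IsPrimitiveRoot (zeta N) N := by
  unfold zeta
  exact Complex.isPrimitiveRoot_exp N hN

/-- `|ζ_N^k| = 1`. [folklore] -/
private theorem norm_zeta_pow {N : ℕ} (hN : N ≠ 0) (k : ℕ) : ‖zeta N ^ k‖ = 1 := by
  rw [norm_pow, (isPrimitiveRoot_zeta hN).norm'_eq_one hN, one_pow]

/-- **`Z_N` noise is a complex unit noise for every `N ≥ 2`** (`Σ_k ζ^k = 0`, `|ζ^k| = 1`).
[cite: DongLiu1994, eq. (1) and "`Z_N` … has no diagonal error"] -/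
theorem isComplexUnitNoise_zLaw {N : ℕ} [NeZero N] (hN : 2 ≤ N) : IsComplexUnitNoise (zLaw N) where
  integrable_norm_pow_four := by
    unfold zLaw
    refine Integrable.smul_measure ?_ (by simp [NeZero.ne N])
    exact integrable_finsetSum_measure.mpr fun k _ => integrable_dirac enorm_lt_top
  integral_id := by
    rw [integral_zLaw N (fun z => z), (isPrimitiveRoot_zeta (NeZero.ne N)).geom_sum_eq_zero hN,
      mul_zero]
  integral_norm_sq := by
    rw [integral_zLaw_real N (fun z => ‖z‖ ^ 2)]
    simp_rw [norm_zeta_pow (NeZero.ne N), one_pow, Finset.sum_const, Finset.card_range,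
      nsmul_eq_mul, mul_one]
    exact inv_mul_cancel₀ (Nat.cast_ne_zero.mpr (NeZero.ne N))

/-- `Z_N` noise has `m₄ = 1` (no diagonal error: `|z| = 1` on every atom).
[cite: DongLiu1994, "`Z_N` … has no diagonal error, i.e. `C₂ = 0`"];
[cite: IitakaEbisuzaki2004, sentence after eq. (29)] -/
theorem mfour_zLaw (N : ℕ) [NeZero N] : mfour (zLaw N) = 1 := by
  unfold mfour
  rw [integral_zLaw_real N (fun z => ‖z‖ ^ 4)]
  simp_rw [norm_zeta_pow (NeZero.ne N), one_pow, Finset.sum_const, Finset.card_range,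
    nsmul_eq_mul, mul_one]
  exact inv_mul_cancel₀ (Nat.cast_ne_zero.mpr (NeZero.ne N))

/-- For `N ≥ 3` the `Z_N` noise has ZERO pseudo-variance: `(1/N)Σ_k ζ^{2k} = 0` since `ζ² ≠ 1`.
[cite: IitakaEbisuzaki2004, eq. (3)] -/
theorem pvar_zLaw {N : ℕ} [NeZero N] (hN : 3 ≤ N) : pvar (zLaw N) = 0 := by
  have hN0 : N ≠ 0 := NeZero.ne N
  unfold pvar
  rw [integral_zLaw N (fun z => z ^ 2)]
  have hζ := isPrimitiveRoot_zeta hN0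
  have hne : zeta N ^ 2 ≠ 1 := by
    rw [Ne, hζ.pow_eq_one_iff_dvd]
    intro h
    have := Nat.le_of_dvd (by norm_num) h
    omega
  have hgeom : ∑ k ∈ Finset.range N, (zeta N ^ k) ^ 2 = 0 := by
    have e : ∀ k : ℕ, (zeta N ^ k) ^ 2 = (zeta N ^ 2) ^ k := fun k => by ring
    simp_rw [e]
    rw [geom_sum_eq hne, ← pow_mul, mul_comm, pow_mul, hζ.pow_eq_one, one_pow, sub_self,
      zero_div]
  rw [hgeom, mul_zero]

/-- For `N = 2` (random SIGN vector `±1`) the pseudo-variance is ONE (real noise).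
[cite: IitakaEbisuzaki2004, eqs. (23)–(27)] -/
theorem pvar_zLaw_two : pvar (zLaw 2) = 1 := by
  unfold pvar
  rw [integral_zLaw 2 (fun z => z ^ 2)]
  have hζ : zeta 2 = -1 := by
    unfold zeta
    rw [show (2 * Real.pi * Complex.I / (2 : ℕ) : ℂ) = Real.pi * Complex.I by push_cast; ring,
      Complex.exp_pi_mul_I]
  rw [hζ, Finset.sum_range_succ, Finset.sum_range_succ, Finset.sum_range_zero]
  norm_num

/-- **Variance with `Z_N` noise, `N ≥ 3`** (a unimodular zero-pseudo-variance noise):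
`E|η†Aη − tr A|² = Σ_{n₁≠n₂}|A_{n₁n₂}|²` — the minimum. [cite: IitakaEbisuzaki2004, eq. (22)];
[cite: DongLiu1994, "`Z_N` … produces a minimum variance"] -/
theorem variance_cEst_zLaw {N : ℕ} [NeZero N] (hN : 3 ≤ N) (A : Matrix n n ℂ) :
    ∫ η, ‖cEst A η - A.trace‖ ^ 2 ∂(Measure.pi fun _ : n => zLaw N) =
      ∑ i, ∑ j, ‖coffd A i j‖ ^ 2 :=
  variance_cEst_of_unimodular (isComplexUnitNoise_zLaw (by omega)) (pvar_zLaw hN) (mfour_zLaw N) A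

/-- **Variance with random SIGN noise (`Z₂`) on a real symmetric matrix**:
`E|η†Xη − tr X|² = 2 Σ_{n₁≠n₂} X_{n₁n₂}²` — "twice of the fluctuation of random phase vectors".
[cite: IitakaEbisuzaki2004, eq. (27)] -/
theorem variance_cEst_zLaw_two {X : Matrix n n ℝ} (hX : X.IsSymm) :
    ∫ η, ‖cEst (X.map ((↑) : ℝ → ℂ)) η - (X.map ((↑) : ℝ → ℂ)).trace‖ ^ 2
        ∂(Measure.pi fun _ : n => zLaw 2) =
      2 * ∑ i, ∑ j, (if i = j then 0 else X i j ^ 2) := by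
  rw [variance_cEst_real_symm (isComplexUnitNoise_zLaw le_rfl) pvar_zLaw_two hX, mfour_zLaw 2]
  simp

end ZN

/-! ## The random PHASE vector (`U(1)` noise `ξ = e^{iθ}`, `θ` uniform on `[−π, π]`) -/

section Phase

/-- The RANDOM PHASE law: the image of the uniform law on `(−π, π]` under `θ ↦ e^{iθ}`.
[cite: IitakaEbisuzaki2004, eq. (18) ("`θ_n` are a set of independent uniform random variables
defined in `[−π, π]`")] -/
def phaseLaw : Measure ℂ :=
  (ENNReal.ofReal (2 * Real.pi))⁻¹ •
    (volume.restrict (Set.Ioc (-Real.pi) Real.pi)).map (fun θ : ℝ => Complex.exp (θ * Complex.I))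

/-- Integration of a continuous function against the random phase law:
`E f(ξ) = (2π)⁻¹ ∫_{−π}^{π} f(e^{iθ}) dθ`. [cite: IitakaEbisuzaki2004, eq. (18)] -/
theorem integral_phaseLaw {E : Type*} [NormedAddCommGroup E] [NormedSpace ℝ E]
    (f : ℂ → E) (hf : Continuous f) :
    ∫ z, f z ∂phaseLaw =
      (2 * Real.pi)⁻¹ • ∫ θ in -Real.pi..Real.pi, f (Complex.exp (θ * Complex.I)) := by
  have hmeas : AEMeasurable (fun θ : ℝ => Complex.exp (θ * Complex.I))
      (volume.restrict (Set.Ioc (-Real.pi) Real.pi)) := by fun_prop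
  unfold phaseLaw
  rw [integral_smul_measure, integral_map hmeas hf.aestronglyMeasurable,
    intervalIntegral.integral_of_le (by linarith [Real.pi_pos]), ENNReal.toReal_inv,
    ENNReal.toReal_ofReal (by positivity)]

/-- `phaseLaw` is a probability measure. [cite: IitakaEbisuzaki2004, eq. (18)] -/
instance isProbabilityMeasure_phaseLaw : IsProbabilityMeasure phaseLaw := by
  constructor
  unfold phaseLaw
  rw [Measure.smul_apply, Measure.map_apply (by fun_prop) MeasurableSet.univ, Set.preimage_univ,
    Measure.restrict_apply MeasurableSet.univ, Set.univ_inter, Real.volume_Ioc, smul_eq_mul,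
    show Real.pi - -Real.pi = 2 * Real.pi by ring]
  exact ENNReal.inv_mul_cancel (by positivity) ENNReal.ofReal_ne_top

/-- The random phase is unimodular: `|ξ| = 1` a.s. [cite: IitakaEbisuzaki2004, eq. (18) and the
sentence after eq. (17)] -/
theorem norm_eq_one_ae_phaseLaw : ∀ᵐ z ∂phaseLaw, ‖z‖ = 1 := by
  unfold phaseLaw
  refine Measure.ae_smul_measure ?_ _
  refine (ae_map_iff (by fun_prop) (measurableSet_eq_fun measurable_norm measurable_const)).mpr ?_
  exact ae_of_all _ fun θ => by simp [Complex.norm_exp_ofReal_mul_I]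

/-- `∫_{−π}^{π} e^{ikθ} dθ = 0` for a nonzero integer `k`. [folklore] -/
private theorem integral_exp_int_mul_I {k : ℤ} (hk : k ≠ 0) :
    ∫ θ in -Real.pi..Real.pi, Complex.exp (k * θ * Complex.I) = 0 := by
  have hc : (k * Complex.I : ℂ) ≠ 0 := mul_ne_zero (by exact_mod_cast hk) Complex.I_ne_zero
  have e : ∀ θ : ℝ, Complex.exp (k * θ * Complex.I) = Complex.exp (k * Complex.I * θ) := fun θ => by
    ring_nf
  simp_rw [e]
  rw [integral_exp_mul_complex hc]
  have h1 : Complex.exp (k * Complex.I * (Real.pi : ℝ)) =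
      Complex.exp (k * Complex.I * ((-Real.pi : ℝ) : ℂ)) := by
    rw [Complex.exp_eq_exp_iff_exists_int]
    exact ⟨k, by push_cast; ring⟩
  rw [h1, sub_self, zero_div]

/-- **The random phase law is a complex unit noise.** [cite: IitakaEbisuzaki2004, eq. (18)
("Obviously … `ξ_n = e^{iθ_n}` satisfies the statistical relations (2)–(4)")] -/
theorem isComplexUnitNoise_phaseLaw : IsComplexUnitNoise phaseLaw where
  integrable_norm_pow_four := by
    refine (integrable_const (1 : ℝ)).congr ?_
    filter_upwards [norm_eq_one_ae_phaseLaw] with z hz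
    simp [hz]
  integral_id := by
    rw [integral_phaseLaw (fun z : ℂ => z) continuous_id]
    have := integral_exp_int_mul_I (k := 1) one_ne_zero
    simp only [Int.cast_one, one_mul] at this
    rw [this, smul_zero]
  integral_norm_sq := by
    have h : (fun z : ℂ => ‖z‖ ^ 2) =ᵐ[phaseLaw] fun _ => (1 : ℝ) := by
      filter_upwards [norm_eq_one_ae_phaseLaw] with z hz
      simp [hz]
    rw [integral_congr_ae h]
    simp

/-- The random phase has zero pseudo-variance: `(2π)⁻¹∫ e^{2iθ} dθ = 0`.
[cite: IitakaEbisuzaki2004, eq. (3) for eq. (18)] -/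
theorem pvar_phaseLaw : pvar phaseLaw = 0 := by
  unfold pvar
  rw [integral_phaseLaw _ (continuous_pow 2)]
  have e : ∀ θ : ℝ, Complex.exp (θ * Complex.I) ^ 2 = Complex.exp ((2 : ℤ) * θ * Complex.I) := by
    intro θ
    rw [← Complex.exp_nat_mul]
    push_cast
    ring_nf
  simp_rw [e]
  rw [integral_exp_int_mul_I (by norm_num), smul_zero]

/-- The random phase has `m₄ = 1`. [cite: IitakaEbisuzaki2004, sentence after eq. (29)
("`⟨⟨|ξ_n|⁴⟩⟩ = 1`" for the random phase vector)] -/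
theorem mfour_phaseLaw : mfour phaseLaw = 1 :=
  (mfour_eq_one_iff isComplexUnitNoise_phaseLaw).mpr norm_eq_one_ae_phaseLaw

/-- **Iitaka–Ebisuzaki eq. (22)**: for random phase vectors
`E|⟨Φ|X|Φ⟩ − tr X|² = Σ_{n₁≠n₂}|X_{n₁n₂}|²` for every complex `X`, "which becomes zero for
diagonal matrices". [cite: IitakaEbisuzaki2004, eq. (22)] -/
theorem variance_cEst_phaseLaw (A : Matrix n n ℂ) :
    ∫ η, ‖cEst A η - A.trace‖ ^ 2 ∂(Measure.pi fun _ : n => phaseLaw) =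
      ∑ i, ∑ j, ‖coffd A i j‖ ^ 2 :=
  variance_cEst_of_unimodular isComplexUnitNoise_phaseLaw pvar_phaseLaw mfour_phaseLaw A

/-- **Random phase beats complex Gaussian** by exactly the diagonal energy `Σᵢ|Aᵢᵢ|²` (the
printed tridiagonal example: fluctuations `2` vs `6` units for phase vs complex Gaussian).
[cite: IitakaEbisuzaki2004, eqs. (16)–(17) and the example after eq. (29)] -/
theorem variance_cEst_gaussian_sub_phaseLaw (A : Matrix n n ℂ) :
    ∫ χ, ‖cEst A χ - A.trace‖ ^ 2 ∂(Measure.pi fun _ : n =>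
        Literature.Computability.QuantumComplexity.stdComplexGaussian) -
      ∫ η, ‖cEst A η - A.trace‖ ^ 2 ∂(Measure.pi fun _ : n => phaseLaw) = ∑ i, ‖A i i‖ ^ 2 := by
  rw [variance_cEst_phaseLaw,
    variance_cEst_of_pvar_eq_zero isComplexUnitNoise_stdComplexGaussian pvar_stdComplexGaussian,
    mfour_stdComplexGaussian]
  ring

end Phase

/-! ## `K` independent probes: the factor `1/K` -/

section Probes

/-- The `K`-probe averaged estimator `(1/K) Σ_k η_k† A η_k`; all probes together form one i.i.d.
noise vector `Z` indexed by `n × Fin K`, probe `k` being `i ↦ Z (i, k)`.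
[cite: IitakaEbisuzaki2004, eq. (14) (`δX = (1/K)Σ_k …`)] -/
def avgCEst (A : Matrix n n ℂ) (K : ℕ) (Z : n × Fin K → ℂ) : ℂ :=
  (∑ k : Fin K, cEst A (fun i => Z (i, k))) / K

omit [DecidableEq n] in
/-- The `K` single-probe estimates add up to ONE probe of the block-diagonal matrix `I_K ⊗ A`.
[cite: IitakaEbisuzaki2004, eq. (15) (independent samples `k`, `k'`)] -/
theorem sum_cEst_eq_blockDiagonal (A : Matrix n n ℂ) (K : ℕ) (Z : n × Fin K → ℂ) :
    ∑ k : Fin K, cEst A (fun i => Z (i, k)) =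
      cEst (Matrix.blockDiagonal fun _ : Fin K => A) Z := by
  unfold cEst
  rw [Fintype.sum_prod_type_right]
  refine Finset.sum_congr rfl fun k _ => Finset.sum_congr rfl fun i _ => ?_
  rw [Fintype.sum_prod_type_right, Finset.sum_comm]
  refine Finset.sum_congr rfl fun j _ => ?_
  simp only [Matrix.blockDiagonal_apply', ite_mul, zero_mul]
  rw [Finset.sum_ite_eq]
  simp

omit [DecidableEq n] in
/-- The block-diagonal matrix has trace `K · tr A`. [cite: IitakaEbisuzaki2004, eq. (13)] -/
theorem trace_blockDiagonal_const (A : Matrix n n ℂ) (K : ℕ) :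
    (Matrix.blockDiagonal fun _ : Fin K => A).trace = K * A.trace := by
  rw [Matrix.trace_blockDiagonal, Finset.sum_const, Finset.card_univ, Fintype.card_fin,
    nsmul_eq_mul]

omit [DecidableEq n] in
/-- Its diagonal energy: `Σ_p |(I_K ⊗ A)_pp|² = K Σᵢ |Aᵢᵢ|²`. [cite: IitakaEbisuzaki2004,
eq. (16)] -/
theorem sum_diag_normSq_blockDiagonal (A : Matrix n n ℂ) (K : ℕ) :
    ∑ p : n × Fin K, ‖(Matrix.blockDiagonal (fun _ : Fin K => A)) p p‖ ^ 2 =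
      K * ∑ i, ‖A i i‖ ^ 2 := by
  rw [Fintype.sum_prod_type_right]
  simp only [Matrix.blockDiagonal_apply_eq, Finset.sum_const, Finset.card_univ, Fintype.card_fin,
    nsmul_eq_mul]

/-- Its off-diagonal energy: `K` copies of that of `A`. [cite: IitakaEbisuzaki2004, eq. (16)] -/
theorem sum_coffd_normSq_blockDiagonal (A : Matrix n n ℂ) (K : ℕ) :
    ∑ p : n × Fin K, ∑ q : n × Fin K, ‖coffd (Matrix.blockDiagonal fun _ : Fin K => A) p q‖ ^ 2 =
      K * ∑ i, ∑ j, ‖coffd A i j‖ ^ 2 := by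
  rw [Fintype.sum_prod_type_right]
  have hinner : ∀ (k : Fin K) (i : n),
      ∑ q : n × Fin K, ‖coffd (Matrix.blockDiagonal fun _ : Fin K => A) (i, k) q‖ ^ 2 =
        ∑ j, ‖coffd A i j‖ ^ 2 := by
    intro k i
    rw [Fintype.sum_prod_type_right, Finset.sum_eq_single k]
    · refine Finset.sum_congr rfl fun j _ => ?_
      have hoffd : coffd (Matrix.blockDiagonal fun _ : Fin K => A) (i, k) (j, k) = coffd A i j := by
        unfold coffd
        simp only [Prod.mk.injEq, and_true, Matrix.blockDiagonal_apply_eq]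
      rw [hoffd]
    · intro k' _ hk'
      refine Finset.sum_eq_zero fun j _ => ?_
      have hoffd : coffd (Matrix.blockDiagonal fun _ : Fin K => A) (i, k) (j, k') = 0 := by
        unfold coffd
        split_ifs with h
        · rfl
        · exact Matrix.blockDiagonal_apply_ne _ _ _ (Ne.symm hk')
      rw [hoffd]; simp
    · simp
  simp_rw [hinner]
  rw [Finset.sum_const, Finset.card_univ, Fintype.card_fin, nsmul_eq_mul]

/-- Its pseudo-variance coefficient: `K` copies of that of `A`. [cite: IitakaEbisuzaki2004,
eq. (16)] -/
theorem sum_coffd_mul_conj_blockDiagonal (A : Matrix n n ℂ) (K : ℕ) :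
    ∑ p : n × Fin K, ∑ q : n × Fin K,
        (coffd (Matrix.blockDiagonal fun _ : Fin K => A) p q *
          conj ((Matrix.blockDiagonal fun _ : Fin K => A) q p)).re =
      K * ∑ i, ∑ j, (coffd A i j * conj (A j i)).re := by
  rw [Fintype.sum_prod_type_right]
  have hinner : ∀ (k : Fin K) (i : n),
      ∑ q : n × Fin K, (coffd (Matrix.blockDiagonal fun _ : Fin K => A) (i, k) q *
          conj ((Matrix.blockDiagonal fun _ : Fin K => A) q (i, k))).re =
        ∑ j, (coffd A i j * conj (A j i)).re := by
    intro k i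
    rw [Fintype.sum_prod_type_right, Finset.sum_eq_single k]
    · refine Finset.sum_congr rfl fun j _ => ?_
      have hoffd : coffd (Matrix.blockDiagonal fun _ : Fin K => A) (i, k) (j, k) = coffd A i j := by
        unfold coffd
        simp only [Prod.mk.injEq, and_true, Matrix.blockDiagonal_apply_eq]
      rw [hoffd, Matrix.blockDiagonal_apply_eq]
    · intro k' _ hk'
      refine Finset.sum_eq_zero fun j _ => ?_
      have hoffd : coffd (Matrix.blockDiagonal fun _ : Fin K => A) (i, k) (j, k') = 0 := by
        unfold coffd
        split_ifs with h
        · rfl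
        · exact Matrix.blockDiagonal_apply_ne _ _ _ (Ne.symm hk')
      rw [hoffd]; simp
    · simp
  simp_rw [hinner]
  rw [Finset.sum_const, Finset.card_univ, Fintype.card_fin, nsmul_eq_mul]

variable (hν : IsComplexUnitNoise ν)
include hν

/-- **The averaged estimator is unbiased**: `E[(1/K) Σ_k η_k† A η_k] = tr A`.
[cite: IitakaEbisuzaki2004, eqs. (13)–(14)] -/
theorem integral_avgCEst (A : Matrix n n ℂ) {K : ℕ} (hK : 0 < K) :
    ∫ Z, avgCEst A K Z ∂(Measure.pi fun _ : n × Fin K => ν) = A.trace := by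
  have hK' : (K : ℂ) ≠ 0 := Nat.cast_ne_zero.mpr hK.ne'
  unfold avgCEst
  simp_rw [sum_cEst_eq_blockDiagonal]
  rw [integral_div, integral_cEst hν, trace_blockDiagonal_const, mul_div_cancel_left₀ _ hK']

/-- **`K` PROBES DIVIDE THE VARIANCE BY `K`** (the factor `1/K` of eq. (16), "the behavior
`|δX| ∼ 1/√K` expected from the central limit theorem"):
`E|(1/K)Σ_k η_k†Aη_k − tr A|² = [(m₄ − 1)Σᵢ|Aᵢᵢ|² + Σ_{i≠j}|Aᵢⱼ|² + |s|²Σ_{i≠j}Re(AᵢⱼĀⱼᵢ)] / K`.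
[cite: IitakaEbisuzaki2004, eq. (16)] -/
theorem variance_avgCEst (A : Matrix n n ℂ) {K : ℕ} (hK : 0 < K) :
    ∫ Z, ‖avgCEst A K Z - A.trace‖ ^ 2 ∂(Measure.pi fun _ : n × Fin K => ν) =
      ((mfour ν - 1) * ∑ i, ‖A i i‖ ^ 2 + ∑ i, ∑ j, ‖coffd A i j‖ ^ 2 +
        ‖pvar ν‖ ^ 2 * ∑ i, ∑ j, (coffd A i j * conj (A j i)).re) / K := by
  have hK' : (K : ℂ) ≠ 0 := Nat.cast_ne_zero.mpr hK.ne'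
  have hKr : (K : ℝ) ≠ 0 := Nat.cast_ne_zero.mpr hK.ne'
  have herr : ∀ Z : n × Fin K → ℂ, avgCEst A K Z - A.trace =
      (cEst (Matrix.blockDiagonal fun _ : Fin K => A) Z -
        (Matrix.blockDiagonal fun _ : Fin K => A).trace) / K := by
    intro Z
    unfold avgCEst
    rw [sum_cEst_eq_blockDiagonal, trace_blockDiagonal_const]
    field_simp
  have hnorm : ∀ Z : n × Fin K → ℂ, ‖avgCEst A K Z - A.trace‖ ^ 2 =
      ‖cEst (Matrix.blockDiagonal fun _ : Fin K => A) Z -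
        (Matrix.blockDiagonal fun _ : Fin K => A).trace‖ ^ 2 / (K : ℝ) ^ 2 := by
    intro Z
    rw [herr, norm_div, div_pow]
    simp
  simp_rw [hnorm]
  rw [integral_div, variance_cEst hν, sum_diag_normSq_blockDiagonal, sum_coffd_normSq_blockDiagonal,
    sum_coffd_mul_conj_blockDiagonal]
  field_simp

end Probes

/-! ## The complex matrix-element estimator `Xᵢ η̄ⱼ` of `Bᵢⱼ = M⁻¹ᵢⱼ` (Dong–Liu eqs. (2), (5))

Appended § (cell pub-lqcd row 38, gen 47).  With `X = Bη` (`B = M⁻¹`, i.e. `X` solves `MX = η`),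
the product `Xᵢ η̄ⱼ = (Σ_k Bᵢₖ η_k) η̄ⱼ` is an unbiased estimator of `Bᵢⱼ` for EVERY complex unit
noise, and its variance is `(m₄ − 1)|Bᵢⱼ|² + Σ_{k≠j}|Bᵢₖ|²`: the "`C₂²`" diagonal term plus the
noise-independent off-diagonal term of eq. (5) (printed for real noise with `[M⁻¹ᵢⱼ]²`,
`[M⁻¹ᵢₖ]²`; here `|·|²`), the pseudo-variance `s` playing no role.  Real case:
`StochasticTrace.integral_elemEst` / `variance_elemEst`. -/

section ElemEst

/-- The single-probe MATRIX-ELEMENT ESTIMATOR `Xᵢ η̄ⱼ = (Σ_k Bᵢₖ η_k) η̄ⱼ` of `Bᵢⱼ` (`X = Bη`,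
`B = M⁻¹`). [cite: DongLiu1994, eq. (2) (`E[M⁻¹ᵢⱼ] = ⟨ηⱼ Xᵢ⟩`, complex noise: `⟨η̄ⱼ Xᵢ⟩`)] -/
def cElemEst (B : Matrix n n ℂ) (i j : n) (η : n → ℂ) : ℂ := (∑ k, B i k * η k) * conj (η j)

variable (hν : IsComplexUnitNoise ν)
include hν

/-- **UNBIASEDNESS of the matrix-element estimator**: `E[Xᵢ η̄ⱼ] = Σ_k Bᵢₖ ⟨η_k η̄ⱼ⟩ = Bᵢⱼ`.
[cite: DongLiu1994, eq. (2)]; [cite: IitakaEbisuzaki2004, eq. (4)] -/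
theorem integral_cElemEst (B : Matrix n n ℂ) (i j : n) :
    ∫ η, cElemEst B i j η ∂(Measure.pi fun _ : n => ν) = B i j := by
  unfold cElemEst
  have e : ∀ η : n → ℂ, (∑ k, B i k * η k) * conj (η j) = ∑ k, B i k * (conj (η j) * η k) := by
    intro η; rw [Finset.sum_mul]; exact Finset.sum_congr rfl fun k _ => by ring
  simp_rw [e]
  rw [integral_finsetSum _ fun k _ => (integrable_conj_mul hν j k).const_mul (B i k)]
  simp_rw [integral_const_mul, integral_conj_mul hν, mul_ite, mul_one, mul_zero]
  rw [Finset.sum_ite_eq]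
  simp

/-- The row of `B` with the `j`-th entry removed: `offRow B i j k = [k ≠ j] Bᵢₖ`.
[cite: DongLiu1994, eq. (5) (the sum `Σ_{k≠j}`)] -/
def offRow (B : Matrix n n ℂ) (i j k : n) : ℂ := if k = j then 0 else B i k

omit hν in
/-- Decomposition of the estimation error: `Xᵢη̄ⱼ − Bᵢⱼ = Bᵢⱼ(η̄ⱼηⱼ − 1) + Σ_{k≠j} Bᵢₖ η̄ⱼ η_k`.
[cite: DongLiu1994, eq. (5) (the two parts of the variance)] -/
theorem cElemEst_sub (B : Matrix n n ℂ) (i j : n) (η : n → ℂ) :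
    cElemEst B i j η - B i j =
      B i j * (conj (η j) * η j - 1) + ∑ k, offRow B i j k * (conj (η j) * η k) := by
  unfold cElemEst
  have hsplit : ∑ k, B i k * (conj (η j) * η k) =
      B i j * (conj (η j) * η j) + ∑ k, offRow B i j k * (conj (η j) * η k) := by
    have hp : ∀ k, B i k * (conj (η j) * η k) =
        (if k = j then B i k * (conj (η j) * η k) else 0) + offRow B i j k * (conj (η j) * η k) := by
      intro k; unfold offRow; split_ifs <;> simp
    rw [Finset.sum_congr rfl fun k _ => hp k, Finset.sum_add_distrib, Finset.sum_ite_eq']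
    simp
  have e : (∑ k, B i k * η k) * conj (η j) = ∑ k, B i k * (conj (η j) * η k) := by
    rw [Finset.sum_mul]; exact Finset.sum_congr rfl fun k _ => by ring
  rw [e, hsplit]
  ring

/-- **EXACT VARIANCE of the matrix-element estimator** (complex form):
`E[(Xᵢη̄ⱼ − Bᵢⱼ)(Xᵢη̄ⱼ − Bᵢⱼ)^*] = (m₄ − 1) Bᵢⱼ B̄ᵢⱼ + Σ_{k≠j} Bᵢₖ B̄ᵢₖ`.
[cite: DongLiu1994, eq. (5)]; [cite: IitakaEbisuzaki2004, eqs. (2)–(4), (16)] -/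
theorem integral_cElemErr_mul_conj (B : Matrix n n ℂ) (i j : n) :
    ∫ η, (cElemEst B i j η - B i j) * conj (cElemEst B i j η - B i j) ∂(Measure.pi fun _ : n => ν) =
      ((mfour ν : ℂ) - 1) * (B i j * conj (B i j)) + ∑ k, offRow B i j k * conj (offRow B i j k) := by
  have hexp : ∀ η : n → ℂ, (cElemEst B i j η - B i j) * conj (cElemEst B i j η - B i j) =
      B i j * conj (B i j) * ((conj (η j) * η j - 1) * (η j * conj (η j) - 1)) +
      ∑ l, B i j * conj (offRow B i j l) * ((conj (η j) * η j - 1) * (η j * conj (η l))) +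
      ∑ k, offRow B i j k * conj (B i j) * (conj (η j) * η k * (η j * conj (η j) - 1)) +
      ∑ k, ∑ l, offRow B i j k * conj (offRow B i j l) *
        (conj (η j) * η k * (η j * conj (η l))) := by
    intro η
    rw [cElemEst_sub, map_add, map_mul, map_sub, map_one, map_mul, Complex.conj_conj, map_sum]
    have hc : ∀ l, conj (offRow B i j l * (conj (η j) * η l)) =
        conj (offRow B i j l) * (η j * conj (η l)) := fun l => by
      simp only [map_mul, Complex.conj_conj]
    simp_rw [hc]
    rw [add_mul, mul_add, mul_add, Finset.mul_sum, Finset.sum_mul, Finset.sum_mul]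
    have t4 : ∑ k, offRow B i j k * (conj (η j) * η k) *
        ∑ l, conj (offRow B i j l) * (η j * conj (η l)) =
        ∑ k, ∑ l, offRow B i j k * conj (offRow B i j l) *
          (conj (η j) * η k * (η j * conj (η l))) := by
      refine Finset.sum_congr rfl fun k _ => ?_
      rw [Finset.mul_sum]
      exact Finset.sum_congr rfl fun l _ => by ring
    rw [t4]
    have t1 : B i j * (conj (η j) * η j - 1) * (conj (B i j) * (η j * conj (η j) - 1)) =
        B i j * conj (B i j) * ((conj (η j) * η j - 1) * (η j * conj (η j) - 1)) := by ring
    have t2 : ∑ l, B i j * (conj (η j) * η j - 1) * (conj (offRow B i j l) * (η j * conj (η l))) =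
        ∑ l, B i j * conj (offRow B i j l) * ((conj (η j) * η j - 1) * (η j * conj (η l))) :=
      Finset.sum_congr rfl fun l _ => by ring
    have t3 : ∑ k, offRow B i j k * (conj (η j) * η k) * (conj (B i j) * (η j * conj (η j) - 1)) =
        ∑ k, offRow B i j k * conj (B i j) * (conj (η j) * η k * (η j * conj (η j) - 1)) :=
      Finset.sum_congr rfl fun k _ => by ring
    rw [t1, t2, t3]
    ring
  simp_rw [hexp]
  have hI1 : Integrable (fun η : n → ℂ =>
      B i j * conj (B i j) * ((conj (η j) * η j - 1) * (η j * conj (η j) - 1)))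
      (Measure.pi fun _ : n => ν) := (integrable_diag_diag hν j j).const_mul _
  have hI2 : ∀ l, Integrable (fun η : n → ℂ =>
      B i j * conj (offRow B i j l) * ((conj (η j) * η j - 1) * (η j * conj (η l))))
      (Measure.pi fun _ : n => ν) := fun l => (integrable_diag_off hν j j l).const_mul _
  have hI3 : ∀ k, Integrable (fun η : n → ℂ =>
      offRow B i j k * conj (B i j) * (conj (η j) * η k * (η j * conj (η j) - 1)))
      (Measure.pi fun _ : n => ν) := fun k => (integrable_off_diag hν j k j).const_mul _
  have hI4 : ∀ k l, Integrable (fun η : n → ℂ =>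
      offRow B i j k * conj (offRow B i j l) * (conj (η j) * η k * (η j * conj (η l))))
      (Measure.pi fun _ : n => ν) := fun k l => (integrable_off_off hν j k j l).const_mul _
  have hS2 : Integrable (fun η : n → ℂ =>
      ∑ l, B i j * conj (offRow B i j l) * ((conj (η j) * η j - 1) * (η j * conj (η l))))
      (Measure.pi fun _ : n => ν) := integrable_finsetSum _ fun l _ => hI2 l
  have hS3 : Integrable (fun η : n → ℂ =>
      ∑ k, offRow B i j k * conj (B i j) * (conj (η j) * η k * (η j * conj (η j) - 1)))
      (Measure.pi fun _ : n => ν) := integrable_finsetSum _ fun k _ => hI3 k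
  have hS4 : Integrable (fun η : n → ℂ =>
      ∑ k, ∑ l, offRow B i j k * conj (offRow B i j l) * (conj (η j) * η k * (η j * conj (η l))))
      (Measure.pi fun _ : n => ν) :=
    integrable_finsetSum _ fun k _ => integrable_finsetSum _ fun l _ => hI4 k l
  have hS12 : Integrable (fun η : n → ℂ =>
      B i j * conj (B i j) * ((conj (η j) * η j - 1) * (η j * conj (η j) - 1)) +
      ∑ l, B i j * conj (offRow B i j l) * ((conj (η j) * η j - 1) * (η j * conj (η l))))
      (Measure.pi fun _ : n => ν) := hI1.add hS2
  have hS123 : Integrable (fun η : n → ℂ =>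
      B i j * conj (B i j) * ((conj (η j) * η j - 1) * (η j * conj (η j) - 1)) +
      ∑ l, B i j * conj (offRow B i j l) * ((conj (η j) * η j - 1) * (η j * conj (η l))) +
      ∑ k, offRow B i j k * conj (B i j) * (conj (η j) * η k * (η j * conj (η j) - 1)))
      (Measure.pi fun _ : n => ν) := hS12.add hS3
  rw [integral_add hS123 hS4, integral_add hS12 hS3, integral_add hI1 hS2,
    integral_finsetSum _ fun l _ => hI2 l, integral_finsetSum _ fun k _ => hI3 k,
    integral_sum₂ hI4]
  -- diagonal term
  have hD : ∫ η, B i j * conj (B i j) * ((conj (η j) * η j - 1) * (η j * conj (η j) - 1))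
      ∂(Measure.pi fun _ : n => ν) = ((mfour ν : ℂ) - 1) * (B i j * conj (B i j)) := by
    rw [integral_const_mul, integral_diag_diag hν j j, if_pos rfl]
    ring
  -- cross terms vanish
  have hX : ∑ l, ∫ η, B i j * conj (offRow B i j l) * ((conj (η j) * η j - 1) * (η j * conj (η l)))
      ∂(Measure.pi fun _ : n => ν) = 0 := by
    refine Finset.sum_eq_zero fun l _ => ?_
    rw [integral_const_mul]
    by_cases hl : l = j
    · simp [offRow, hl]
    · rw [integral_diag_off hν j (Ne.symm hl), mul_zero]
  have hX' : ∑ k, ∫ η, offRow B i j k * conj (B i j) * (conj (η j) * η k * (η j * conj (η j) - 1))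
      ∂(Measure.pi fun _ : n => ν) = 0 := by
    refine Finset.sum_eq_zero fun k _ => ?_
    rw [integral_const_mul]
    by_cases hk : k = j
    · simp [offRow, hk]
    · rw [integral_off_diag hν (Ne.symm hk) j, mul_zero]
  -- off-diagonal term
  have hR : ∑ k, ∑ l, ∫ η, offRow B i j k * conj (offRow B i j l) *
      (conj (η j) * η k * (η j * conj (η l))) ∂(Measure.pi fun _ : n => ν) =
      ∑ k, offRow B i j k * conj (offRow B i j k) := by
    refine Finset.sum_congr rfl fun k _ => ?_
    by_cases hk : k = j
    · simp [offRow, hk]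
    · have hterm : ∀ l, ∫ η, offRow B i j k * conj (offRow B i j l) *
          (conj (η j) * η k * (η j * conj (η l))) ∂(Measure.pi fun _ : n => ν) =
          if l = k then offRow B i j k * conj (offRow B i j l) else 0 := by
        intro l
        rw [integral_const_mul]
        by_cases hl : l = j
        · subst hl
          simp [offRow, Ne.symm hk]
        · rw [integral_off_off hν (Ne.symm hk) (Ne.symm hl)]
          have h2 : ¬(j = k ∧ l = j) := fun h => hk h.1.symm
          rw [if_neg h2, add_zero]
          by_cases hlk : l = k
          · subst hlk; simp
          · have h1 : ¬(j = j ∧ l = k) := fun h => hlk h.2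
            rw [if_neg h1, if_neg hlk, mul_zero]
      rw [Finset.sum_congr rfl fun l _ => hterm l, Finset.sum_ite_eq']
      simp
  rw [hD, hX, hX', hR]
  ring

/-- **EXACT VARIANCE of the matrix-element estimator**:
`E|Xᵢη̄ⱼ − Bᵢⱼ|² = (m₄ − 1)|Bᵢⱼ|² + Σ_{k≠j} |Bᵢₖ|²` — Dong–Liu's eq. (5) at `L = 1` for complex
noise: the first ("`C₂²`") term vanishes for every unimodular noise (`Z₂`, `Z_N`, random phase), the
second is independent of the kind of noise used, and the pseudo-variance does not enter.
[cite: DongLiu1994, eq. (5) and "the first part is proportional to the square of the diagonal error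
`C₂` only"]; [cite: IitakaEbisuzaki2004, eqs. (2)–(4), (16)] -/
theorem variance_cElemEst (B : Matrix n n ℂ) (i j : n) :
    ∫ η, ‖cElemEst B i j η - B i j‖ ^ 2 ∂(Measure.pi fun _ : n => ν) =
      (mfour ν - 1) * ‖B i j‖ ^ 2 + ∑ k, ‖offRow B i j k‖ ^ 2 := by
  have hC := integral_cElemErr_mul_conj hν B i j
  have e1 : ∀ w : ℂ, w * conj w = ((‖w‖ ^ 2 : ℝ) : ℂ) := fun w => by
    rw [Complex.mul_conj, Complex.normSq_eq_norm_sq]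
  simp_rw [e1, integral_complex_ofReal] at hC
  apply Complex.ofReal_injective
  rw [hC]
  push_cast
  ring

/-- For UNIMODULAR noise (`m₄ = 1`: `Z₂`, `Z_N`, random phase) the element variance is the
noise-independent `Σ_{k≠j}|Bᵢₖ|²` — "`Z₂`, or `Z_N` for that matter, has no diagonal error …
it produces a minimum variance". [cite: DongLiu1994, sentence after eq. (5)] -/
theorem variance_cElemEst_of_unimodular (h1 : mfour ν = 1) (B : Matrix n n ℂ) (i j : n) :
    ∫ η, ‖cElemEst B i j η - B i j‖ ^ 2 ∂(Measure.pi fun _ : n => ν) =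
      ∑ k, ‖offRow B i j k‖ ^ 2 := by
  rw [variance_cElemEst hν, h1]
  simp

/-- The diagonal error is never a gain: every complex unit noise has element variance at least the
unimodular one. [cite: DongLiu1994, "Other noises will have larger variances due to the
non-vanishing `C₂`"] -/
theorem offRow_le_variance_cElemEst (B : Matrix n n ℂ) (i j : n) :
    ∑ k, ‖offRow B i j k‖ ^ 2 ≤
      ∫ η, ‖cElemEst B i j η - B i j‖ ^ 2 ∂(Measure.pi fun _ : n => ν) := by
  rw [variance_cElemEst hν]
  have h1 := one_le_mfour hν
  have h2 : 0 ≤ ‖B i j‖ ^ 2 := sq_nonneg _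
  nlinarith

end ElemEst

end ComplexNoiseTrace

end Literature.Probability.Moments
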